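import Literature.NumberTheory.LFunctions.MoebiusExpSumMinorArc
import Literature.NumberTheory.LFunctions.MoebiusTwoPowerModuli
import Literature.NumberTheory.Sieve.RamanujanSum
import HarnessLib

/-!
# Exponential sums over `λ` at sparse dyadic rationals (Green 2012, §4: Corollaries 1–2,
# Lemma 1 and Proposition 3, for the Liouville function), proved from Green's Theorem 3

Topic `Literature/NumberTheory/LFunctions`. Everything in this file is PROVED (theorems only),
CONDITIONALLY on the tree's named fact
`Literature.NumberTheory.LFunctions.green_moebius_character_twoPower` (Green 2012, Theorem 3:
`∑_{x<N} μ(x)χ(x) ≪ N e^{-c₂√log N}` for `χ` mod `2^t ≤ e^{c₂√log N}`, `MoebiusTwoPowerModuli.lean`),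
which enters as an explicit hypothesis `(hX : green_moebius_character_twoPower)` (it is proved in
the tree, `MoebiusTwoPowerModuliProofs.lean`, which this file deliberately does not import). It is
the analytic input of the proof of `Literature.NumberTheory.LFunctions.green_liouville_fourierWalsh`
(Green 2012, Proposition 1 for `λ`). Lemma 1 is also in the tree in two other renderings
(`MoebiusWalshDyadic.lean`: exponents `i : Fin k → ℕ`; `HarmanKataiLemma.lean`: a set of
exponents); the digit-indexed form `harmanKatai` below (numerators `r : Fin n → ℤ`, the sparse
dyadic rational `dyadic r = Σ_i r_i/2^{i+1}` of this file) is the one consumed by Proposition 3.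

B. Green, *On (not) computing the Möbius function using bounded depth circuits*, Combin. Probab.
Comput. 21 (2012), §4 (numbering of arXiv:1103.4991):
* Corollary 1: `∑_{x<N} μ(x) e(ax/2^t) = O(N e^{-c₃√log N})` for `2^t ≤ e^{c₃√log N}` — from
  Theorem 3 by Fourier analysis on `(ℤ/2^tℤ)^*` for odd `x`, `μ(2x) = -μ(x)` for `x ≡ 2 (4)` and
  `μ(x) = 0` for `4 ∣ x` (`Green2012.moebius_dyadic_expSum`); the same for `λ` through
  `λ = 𝟙_□ ⋆ μ` (`Green2012.liouville_dyadic_expSum`; Green §1: "All of the results in this paper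
  hold equally well for the Liouville function").
* Corollary 2: `|θ - a/q| ≤ Q/N`, `q = 2^t ≤ Q = e^{c₄√log N}` ⟹ `λ̂(θ) = O(e^{-c₄√log N})`
  (blocks of length `L`, `Green2012.liouville_near_dyadic`).
* Lemma 1 (Harman–Kátai): a sparse dyadic rational close to `a/q`, `q` small, has `q` a power of
  two (`Green2012.harmanKatai`).
* Proposition 3 for `λ`: `λ̂(θ) = O(e^{-c₁√log N})` at sparse dyadic `θ` with `k ≤ √n` terms and
  numerators `≤ e^{c₁√log N}` (`Green2012.liouville_sparse_dyadic`), from Proposition 4 for `λ`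
  (`MoebiusExpSum.liouville_minorArc`, proved in `MoebiusExpSumMinorArc.lean`), Lemma 1 and
  Corollary 2.

## References

* B. Green, Combin. Probab. Comput. 21 (2012) 942–951, §4 [Green2012].
* G. Harman, I. Kátai, *Primes with preassigned digits II*, Acta Arith. 133 (2008) 171–184
  (Lemma 1, as cited by Green).
-/

noncomputable section

open Finset Real ArithmeticFunction
open scoped FourierTransform ArithmeticFunction.Moebius

namespace Literature.NumberTheory.LFunctions

namespace Green2012

open Literature.NumberTheory.Sieve.Vinogradov (afExpSum)
open Literature.NumberTheory.Sieve.RamanujanSum (fourierChar_intCast)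

/-! ### Exponential sums over `x < N` and sparse dyadic rationals -/

/-- `e(s + t) = e(s) e(t)` (coerced to `ℂ`). [folklore] -/
theorem fourierChar_add (s t : ℝ) : (𝐞 (s + t) : ℂ) = (𝐞 s : ℂ) * (𝐞 t : ℂ) := by
  rw [AddChar.map_add_eq_mul, Circle.coe_mul]

/-- `e(t + a) = e(t)` for `a ∈ ℤ`. [folklore] -/
theorem fourierChar_add_intCast (t : ℝ) (a : ℤ) : (𝐞 (t + a) : ℂ) = (𝐞 t : ℂ) := by
  rw [fourierChar_add, fourierChar_intCast, mul_one]

/-- The exponential sum `Σ_{x<N} f(x) e(θx)` (Green's `N · f̂(θ)`, summation over `0 ≤ x < N`).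
[cite: Green2012, §3] -/
def expSum (f : ℕ → ℝ) (N : ℕ) (θ : ℝ) : ℂ := ∑ x ∈ range N, (f x : ℂ) * (𝐞 (θ * x) : ℂ)

/-- The trivial bound `‖Σ_{x<N} f(x)e(θx)‖ ≤ N` for `|f| ≤ 1`. [folklore] -/
theorem norm_expSum_le {f : ℕ → ℝ} (hf : ∀ x, |f x| ≤ 1) (N : ℕ) (θ : ℝ) :
    ‖expSum f N θ‖ ≤ N := by
  unfold expSum
  refine (norm_sum_le _ _).trans ?_
  calc ∑ x ∈ range N, ‖(f x : ℂ) * (𝐞 (θ * x) : ℂ)‖ ≤ ∑ _x ∈ range N, (1 : ℝ) :=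
        Finset.sum_le_sum fun x _ => by
          rw [norm_mul, Literature.NumberTheory.Sieve.Vinogradov.norm_fourierChar, mul_one,
            Complex.norm_real, Real.norm_eq_abs]; exact hf x
    _ = N := by simp

/-- The sparse dyadic rational `θ = Σ_i r_i/2^{i+1}` with numerators `r : Fin n → ℤ` indexed by
the binary digits (tree digit `i` ↔ weight `2^i`; Green's `r_1/2^{i_1} + ⋯ + r_k/2^{i_k}` has
`r` supported on `k` digits). [cite: Green2012, Proposition 2] -/
def dyadic {n : ℕ} (r : Fin n → ℤ) : ℝ := ∑ i : Fin n, (r i : ℝ) / 2 ^ ((i : ℕ) + 1)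

/-! ### Additive characters on odd residues in terms of Dirichlet characters -/

section Characters

variable {q : ℕ} [NeZero q]

/-- The coefficient of `χ` in the expansion of `x ↦ e(bx/q)` on the units:
`τ(χ, b) = ∑_{r<q, (r,q)=1} e(br/q) χ(r)⁻¹`. [cite: Green2012, §4 (proof of Corollary 1)] -/
def addCoeff (χ : DirichletCharacter ℂ q) (b : ℤ) : ℂ :=
  ∑ r ∈ (range q).filter (fun r => r.Coprime q), (𝐞 ((b : ℝ) * r / q) : ℂ) * χ (r : ZMod q)⁻¹

omit [NeZero q] in
/-- `‖τ(χ, b)‖ ≤ q`. [folklore] -/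
theorem norm_addCoeff_le (χ : DirichletCharacter ℂ q) (b : ℤ) : ‖addCoeff χ b‖ ≤ q := by
  unfold addCoeff
  refine (norm_sum_le _ _).trans ?_
  calc ∑ r ∈ (range q).filter (fun r => r.Coprime q), ‖(𝐞 ((b : ℝ) * r / q) : ℂ) * χ (r : ZMod q)⁻¹‖
      ≤ ∑ _r ∈ (range q).filter (fun r => r.Coprime q), (1 : ℝ) := Finset.sum_le_sum fun r _ => by
        rw [norm_mul, Literature.NumberTheory.Sieve.Vinogradov.norm_fourierChar, one_mul]
        exact DirichletCharacter.norm_le_one χ _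
    _ ≤ ∑ _r ∈ range q, (1 : ℝ) :=
        Finset.sum_le_sum_of_subset_of_nonneg (Finset.filter_subset _ _) fun _ _ _ => zero_le_one
    _ = q := by simp

/-- **Fourier expansion on `(ℤ/qℤ)^*`**: for `x` coprime to `q`,
`e(bx/q) = (1/φ(q)) ∑_χ τ(χ, b) χ(x)` ("if `x ∈ (ℤ/2^tℤ)^*` then `∑_χ χ(x)` equals `2^{t-1}` if
`x = 1` and vanishes otherwise … it follows that `e(ax/2^t) = …` for all odd `x`").
[cite: Green2012, §4 (proof of Corollary 1)] -/
theorem fourierChar_eq_sum_addCoeff (b : ℤ) {x : ℕ} (hx : x.Coprime q) :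
    (𝐞 ((b : ℝ) * x / q) : ℂ) =
      (1 / (q.totient : ℂ)) * ∑ χ : DirichletCharacter ℂ q, addCoeff χ b * χ (x : ZMod q) := by
  have hq : 0 < q := Nat.pos_of_ne_zero (NeZero.ne q)
  have hφ : (q.totient : ℂ) ≠ 0 := by exact_mod_cast (Nat.totient_pos.mpr hq).ne'
  -- expand and use orthogonality
  have key : ∑ χ : DirichletCharacter ℂ q, addCoeff χ b * χ (x : ZMod q) =
      ∑ r ∈ (range q).filter (fun r => r.Coprime q), (𝐞 ((b : ℝ) * r / q) : ℂ) *
        (if (r : ZMod q) = (x : ZMod q) then (q.totient : ℂ) else 0) := by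
    simp only [addCoeff, Finset.sum_mul]
    rw [Finset.sum_comm]
    refine Finset.sum_congr rfl fun r hr => ?_
    have hrc : r.Coprime q := (Finset.mem_filter.mp hr).2
    have hru : IsUnit (r : ZMod q) := (ZMod.isUnit_iff_coprime r q).mpr hrc
    rw [← DirichletCharacter.sum_char_inv_mul_char_eq ℂ hru (x : ZMod q), Finset.mul_sum]
    refine Finset.sum_congr rfl fun χ _ => ?_
    ring
  rw [key]
  -- only `r = x % q` survives
  have hmem : x % q ∈ (range q).filter (fun r => r.Coprime q) := by
    rw [Finset.mem_filter, Finset.mem_range]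
    refine ⟨Nat.mod_lt x hq, ?_⟩
    have hg : Nat.gcd (x % q) q = Nat.gcd q x := (Nat.gcd_rec q x).symm
    unfold Nat.Coprime; rw [hg]; exact hx.symm
  rw [Finset.sum_eq_single_of_mem (x % q) hmem]
  · rw [if_pos (by simp)]
    have hper : (𝐞 ((b : ℝ) * (x % q : ℕ) / q) : ℂ) = (𝐞 ((b : ℝ) * x / q) : ℂ) := by
      set d : ℕ := x / q with hd
      set m : ℕ := x % q with hm
      have hdm : q * d + m = x := Nat.div_add_mod x q
      have hx' : (x : ℝ) = (q : ℝ) * d + m := by exact_mod_cast hdm.symm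
      have hq' : (q : ℝ) ≠ 0 := by exact_mod_cast hq.ne'
      have : (b : ℝ) * x / q = (b : ℝ) * m / q + ((b * d : ℤ) : ℝ) := by
        rw [hx']; push_cast; field_simp; ring
      rw [this, fourierChar_add_intCast]
    rw [hper]
    field_simp
  · intro r hr hne
    rw [if_neg, mul_zero]
    intro h
    apply hne
    have hr' := Finset.mem_range.mp (Finset.mem_filter.mp hr).1
    have h1 : (r : ZMod q) = ((x % q : ℕ) : ZMod q) := by rw [h, ZMod.natCast_mod]
    have h2 := (ZMod.natCast_eq_natCast_iff' r (x % q) q).mp h1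
    rw [Nat.mod_eq_of_lt hr', Nat.mod_mod_of_dvd _ (dvd_refl q)] at h2
    exact h2

/-- **From characters to additive phases on the units**: if `‖∑_{x<N} f(x)χ(x)‖ ≤ B` for every
Dirichlet character `χ` mod `q`, then `‖∑_{x<N, (x,q)=1} f(x) e(bx/q)‖ ≤ q B`.
[cite: Green2012, §4 (proof of Corollary 1)] -/
theorem norm_sum_coprime_fourierChar_le (f : ℕ → ℂ) (N : ℕ) (b : ℤ) {B : ℝ}
    (hB : ∀ χ : DirichletCharacter ℂ q, ‖∑ x ∈ range N, f x * χ (x : ZMod q)‖ ≤ B) :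
    ‖∑ x ∈ (range N).filter (fun x => x.Coprime q), f x * (𝐞 ((b : ℝ) * x / q) : ℂ)‖ ≤ q * B := by
  have hq : 0 < q := Nat.pos_of_ne_zero (NeZero.ne q)
  have hφ0 : 0 < q.totient := Nat.totient_pos.mpr hq
  have hφ : (q.totient : ℂ) ≠ 0 := by exact_mod_cast hφ0.ne'
  have hB0 : 0 ≤ B := le_trans (norm_nonneg _) (hB 1)
  -- rewrite with the expansion; non-coprime `x` have `χ(x) = 0`
  have h1 : ∑ x ∈ (range N).filter (fun x => x.Coprime q), f x * (𝐞 ((b : ℝ) * x / q) : ℂ) =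
      (1 / (q.totient : ℂ)) * ∑ χ : DirichletCharacter ℂ q, addCoeff χ b *
        ∑ x ∈ range N, f x * χ (x : ZMod q) := by
    rw [Finset.mul_sum]
    have h2 : ∀ χ : DirichletCharacter ℂ q, ∑ x ∈ range N, f x * χ (x : ZMod q) =
        ∑ x ∈ (range N).filter (fun x => x.Coprime q), f x * χ (x : ZMod q) := by
      intro χ
      rw [Finset.sum_filter]
      refine Finset.sum_congr rfl fun x _ => ?_
      split_ifs with hx
      · rfl
      · rw [χ.map_nonunit (by rwa [ZMod.isUnit_iff_coprime]), mul_zero]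
    simp_rw [h2, Finset.mul_sum]
    rw [Finset.sum_comm]
    refine Finset.sum_congr rfl fun x hx => ?_
    have hxc : x.Coprime q := (Finset.mem_filter.mp hx).2
    rw [fourierChar_eq_sum_addCoeff b hxc, Finset.mul_sum, Finset.mul_sum]
    refine Finset.sum_congr rfl fun χ _ => ?_
    ring
  rw [h1, norm_mul, norm_div, norm_one, Complex.norm_natCast]
  have h3 : ‖∑ χ : DirichletCharacter ℂ q, addCoeff χ b * ∑ x ∈ range N, f x * χ (x : ZMod q)‖ ≤
      (q.totient : ℝ) * (q * B) := by
    refine (norm_sum_le _ _).trans ?_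
    calc ∑ χ : DirichletCharacter ℂ q, ‖addCoeff χ b * ∑ x ∈ range N, f x * χ (x : ZMod q)‖
        ≤ ∑ _χ : DirichletCharacter ℂ q, (q : ℝ) * B := Finset.sum_le_sum fun χ _ => by
          rw [norm_mul]
          exact mul_le_mul (norm_addCoeff_le χ b) (hB χ) (norm_nonneg _) (Nat.cast_nonneg _)
      _ = (Fintype.card (DirichletCharacter ℂ q) : ℝ) * (q * B) := by
          rw [Finset.sum_const, Finset.card_univ, nsmul_eq_mul]
      _ = (q.totient : ℝ) * (q * B) := by
          rw [← Nat.card_eq_fintype_card, DirichletCharacter.card_eq_totient_of_hasEnoughRootsOfUnity]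
  have hφr : (0 : ℝ) < q.totient := by exact_mod_cast hφ0
  calc 1 / (q.totient : ℝ) * ‖∑ χ : DirichletCharacter ℂ q, addCoeff χ b * ∑ x ∈ range N, f x * χ (x : ZMod q)‖
      ≤ 1 / (q.totient : ℝ) * ((q.totient : ℝ) * (q * B)) :=
        mul_le_mul_of_nonneg_left h3 (by positivity)
    _ = q * B := by field_simp

end Characters

/-! ### Elementary estimates used to absorb small savings -/

/-- `x^m ≤ (m/A)^m e^{Ax}` for `x ≥ 0`, `A > 0` (from `y ≤ e^{y-1}`). [folklore] -/
theorem pow_le_mul_exp (m : ℕ) {A x : ℝ} (hA : 0 < A) (hx : 0 ≤ x) :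
    x ^ m ≤ ((m : ℝ) / A) ^ m * Real.exp (A * x) := by
  rcases Nat.eq_zero_or_pos m with rfl | hm
  · simp [Real.one_le_exp (mul_nonneg hA.le hx)]
  have hm' : (0 : ℝ) < m := by exact_mod_cast hm
  -- `y ≤ e^{y-1} ≤ e^y` with `y = Ax/m`
  have h1 : A * x / m ≤ Real.exp (A * x / m) := by
    have := Real.add_one_le_exp (A * x / m - 1)
    have h2 : Real.exp (A * x / m - 1) ≤ Real.exp (A * x / m) := Real.exp_le_exp.mpr (by linarith)
    linarith
  have h0 : 0 ≤ A * x / m := by positivity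
  have h3 : (A * x / m) ^ m ≤ Real.exp (A * x / m) ^ m := pow_le_pow_left₀ h0 h1 m
  rw [← Real.exp_nat_mul, mul_div_cancel₀ _ hm'.ne'] at h3
  have e : x ^ m = ((m : ℝ) / A) ^ m * (A * x / m) ^ m := by
    rw [← mul_pow]; congr 1; field_simp
  rw [e]
  exact mul_le_mul_of_nonneg_left h3 (by positivity)

/-- **Polynomial savings are exponential-in-`√log` savings**: for `N ≥ 1`, `d > 0` and real `b`,
`N^{1-d} ≤ e^{b²/(4d)} · N · e^{-b√log N}`. [folklore] -/
theorem rpow_le_mul_exp_neg_sqrt_log {N : ℝ} (hN : 1 ≤ N) {d : ℝ} (b : ℝ) (hd : 0 < d) :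
    N ^ (1 - d) ≤ Real.exp (b ^ 2 / (4 * d)) * N * Real.exp (-(b * Real.sqrt (Real.log N))) := by
  have hN0 : 0 < N := by linarith
  set u := Real.sqrt (Real.log N) with hu
  have hlog : 0 ≤ Real.log N := Real.log_nonneg hN
  have hu2 : u ^ 2 = Real.log N := Real.sq_sqrt hlog
  rw [Real.rpow_def_of_pos hN0, show Real.log N * (1 - d) = Real.log N + (-(d * u ^ 2)) by rw [hu2]; ring,
    Real.exp_add, Real.exp_log hN0, mul_comm (Real.exp (b ^ 2 / (4 * d))) N, mul_assoc,
    ← Real.exp_add]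
  refine mul_le_mul_of_nonneg_left (Real.exp_le_exp.mpr ?_) hN0.le
  -- `-d u² ≤ b²/(4d) - b u`
  have key : 0 ≤ d * u ^ 2 - b * u + b ^ 2 / (4 * d) := by
    have : d * u ^ 2 - b * u + b ^ 2 / (4 * d) = (2 * d * u - b) ^ 2 / (4 * d) := by
      field_simp; ring
    rw [this]; positivity
  linarith

/-- `√(u - v) ≥ √u - √v`... in the form used: `√(log N - log 2) ≥ √(log N) - 1`, i.e.
`e^{-c√log M} ≤ e^{c} e^{-c√log N}` whenever `N ≤ 2M` (`c ≥ 0`). [folklore] -/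
theorem exp_neg_sqrt_log_le_of_le_two_mul {N M : ℝ} (hN : 0 ≤ N) (hM : 1 ≤ M) (hNM : N ≤ 2 * M)
    {c : ℝ} (hc : 0 ≤ c) :
    Real.exp (-(c * Real.sqrt (Real.log M))) ≤ Real.exp c * Real.exp (-(c * Real.sqrt (Real.log N))) := by
  rw [← Real.exp_add]
  refine Real.exp_le_exp.mpr ?_
  -- `√log N ≤ √log M + 1`
  have h1 : Real.sqrt (Real.log N) ≤ Real.sqrt (Real.log M) + 1 := by
    rcases le_or_gt N 1 with hN1 | hN1
    · have : Real.log N ≤ 0 := Real.log_nonpos hN hN1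
      rw [Real.sqrt_eq_zero'.mpr this]
      positivity
    · have hlogN : Real.log N ≤ Real.log M + Real.log 2 := by
        rw [← Real.log_mul (by linarith) (by norm_num)]
        exact Real.log_le_log (by linarith) (by linarith)
      have hlog2 : Real.log 2 ≤ 1 := by
        have := Real.log_two_lt_d9; linarith
      have hM0 : 0 ≤ Real.log M := Real.log_nonneg hM
      calc Real.sqrt (Real.log N) ≤ Real.sqrt (Real.log M + 1) :=
            Real.sqrt_le_sqrt (by linarith)
        _ ≤ Real.sqrt (Real.log M) + 1 := by
            rw [Real.sqrt_le_left (by positivity)]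
            nlinarith [Real.sq_sqrt hM0, Real.sqrt_nonneg (Real.log M)]
  nlinarith [mul_le_mul_of_nonneg_left h1 hc]

/-! ### Green's Corollary 1 for `μ`: exponential sums at dyadic rationals -/

/-- `μ(2y) = -μ(y)` for odd `y`, `μ(2y) = 0` for even `y`. [folklore] -/
theorem moebius_two_mul (y : ℕ) : (μ (2 * y) : ℝ) = if Odd y then -(μ y : ℝ) else 0 := by
  split_ifs with hy
  · have hcop : Nat.Coprime 2 y := Nat.coprime_two_left.mpr hy
    rw [ArithmeticFunction.isMultiplicative_moebius.map_mul_of_coprime hcop,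
      ArithmeticFunction.moebius_apply_prime Nat.prime_two]
    push_cast; ring
  · rw [Nat.not_odd_iff_even] at hy
    obtain ⟨k, rfl⟩ := hy
    have : ¬ Squarefree (2 * (k + k)) := by
      intro h
      have := h 2 ⟨k, by ring⟩
      norm_num at this
    rw [ArithmeticFunction.moebius_eq_zero_of_not_squarefree this]
    simp

/-- Splitting a sum over `x < N` into odd and even `x`, the even ones written `x = 2y`,
`y < (N+1)/2`. [folklore] -/
theorem sum_range_eq_odd_add_even (F : ℕ → ℂ) (N : ℕ) :
    ∑ x ∈ range N, F x = ∑ x ∈ (range N).filter Odd, F x + ∑ y ∈ range ((N + 1) / 2), F (2 * y) := by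
  rw [← Finset.sum_filter_add_sum_filter_not (range N) Odd]
  congr 1
  refine Finset.sum_nbij' (fun x => x / 2) (fun y => 2 * y) ?_ ?_ ?_ ?_ ?_
  · intro x hx
    rw [Finset.mem_filter, Finset.mem_range] at hx
    rw [Finset.mem_range]; omega
  · intro y hy
    rw [Finset.mem_range] at hy
    rw [Finset.mem_filter, Finset.mem_range, Nat.not_odd_iff_even]
    exact ⟨by omega, even_two_mul y⟩
  · intro x hx
    rw [Finset.mem_filter, Nat.not_odd_iff_even] at hx
    obtain ⟨k, hk⟩ := hx.2
    show 2 * (x / 2) = x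
    omega
  · intro y _
    show 2 * y / 2 = y
    omega
  · intro x hx
    rw [Finset.mem_filter, Nat.not_odd_iff_even] at hx
    obtain ⟨k, hk⟩ := hx.2
    show F x = F (2 * (x / 2))
    congr 1; omega

/-- For `t ≥ 1`, "coprime to `2^t`" means "odd". [folklore] -/
theorem filter_coprime_two_pow_eq {t : ℕ} (ht : 1 ≤ t) (N : ℕ) :
    (range N).filter (fun x => x.Coprime (2 ^ t)) = (range N).filter Odd := by
  refine Finset.filter_congr fun x _ => ?_
  rw [Nat.coprime_pow_right_iff ht, Nat.coprime_two_right]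

/-- **Green 2012, Corollary 1** (for `μ`, from Theorem 3): there are absolute `c₃ > 0`, `K₃`
such that `‖∑_{x<N} μ(x) e(ax/2^t)‖ ≤ K₃ N e^{-c₃√log N}` uniformly for `2^t ≤ e^{c₃√log N}`,
`a ∈ ℤ` — Fourier analysis on `(ℤ/2^tℤ)^*` for odd `x` (`norm_sum_coprime_fourierChar_le`),
`μ(2y) = -μ(y)` for the `x ≡ 2 (4)` and `μ(x) = 0` for `4 ∣ x`; conditional on Theorem 3 (`hX`).
[cite: Green2012, Corollary 1] -/
theorem moebius_dyadic_expSum (hX : green_moebius_character_twoPower) :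
    ∃ c₃ : ℝ, 0 < c₃ ∧ ∃ K₃ : ℝ, 0 ≤ K₃ ∧ ∀ (t N : ℕ) (a : ℤ),
      (2 : ℝ) ^ t ≤ Real.exp (c₃ * Real.sqrt (Real.log N)) →
      ‖∑ x ∈ range N, ((μ x : ℝ) : ℂ) * (𝐞 ((a : ℝ) * x / (2 ^ t : ℕ)) : ℂ)‖ ≤
        K₃ * N * Real.exp (-(c₃ * Real.sqrt (Real.log N))) := by
  obtain ⟨c₂, hc₂, K, hK⟩ := hX
  set K' : ℝ := max K 0 with hK'
  have hK'0 : 0 ≤ K' := le_max_right _ _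
  have hK' : ∀ (t N : ℕ) (χ : DirichletCharacter ℂ (2 ^ t)),
      (2 : ℝ) ^ t ≤ Real.exp (c₂ * Real.sqrt (Real.log N)) →
      ‖∑ x ∈ range N, ((μ x : ℝ) : ℂ) * χ (x : ZMod (2 ^ t))‖ ≤
        K' * N * Real.exp (-(c₂ * Real.sqrt (Real.log N))) := by
    intro t N χ h
    have := hK t N χ h
    have e : ∑ x ∈ range N, ((μ x : ℤ) : ℂ) * χ (x : ZMod (2 ^ t)) =
        ∑ x ∈ range N, ((μ x : ℝ) : ℂ) * χ (x : ZMod (2 ^ t)) :=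
      Finset.sum_congr rfl fun x _ => by push_cast; rfl
    rw [e] at this
    refine this.trans ?_
    gcongr
    exact le_max_left _ _
  refine ⟨c₂ / 2, by positivity, (K' * (1 + Real.exp c₂) + 1) * Real.exp c₂, by positivity,
    fun t N a ht => ?_⟩
  have hE : 0 < Real.exp (-(c₂ / 2 * Real.sqrt (Real.log N))) := Real.exp_pos _
  -- the trivial bound `≤ N`
  have htriv : ‖∑ x ∈ range N, ((μ x : ℝ) : ℂ) * (𝐞 ((a : ℝ) * x / (2 ^ t : ℕ)) : ℂ)‖ ≤ N := by
    refine (norm_sum_le _ _).trans ?_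
    calc ∑ x ∈ range N, ‖((μ x : ℝ) : ℂ) * (𝐞 ((a : ℝ) * x / (2 ^ t : ℕ)) : ℂ)‖ ≤ ∑ _x ∈ range N, (1 : ℝ) :=
          Finset.sum_le_sum fun x _ => by
            rw [norm_mul, Literature.NumberTheory.Sieve.Vinogradov.norm_fourierChar, mul_one,
              Complex.norm_real, Real.norm_eq_abs]
            exact_mod_cast ArithmeticFunction.abs_moebius_le_one
      _ = N := by simp
  -- small `N`
  by_cases hN : N < 3
  · refine htriv.trans ?_
    -- `√log N ≤ 1` so `e^{-(c₂/2)√log N} ≥ e^{-c₂/2} ≥ e^{-c₂}`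
    have hlog : Real.sqrt (Real.log N) ≤ 1 := by
      rw [Real.sqrt_le_left zero_le_one, one_pow]
      rcases Nat.eq_zero_or_pos N with rfl | hN0
      · simp
      · have : (N : ℝ) ≤ 2 := by exact_mod_cast (by omega : N ≤ 2)
        calc Real.log N ≤ Real.log 2 := Real.log_le_log (by exact_mod_cast hN0) this
          _ ≤ 1 := by have := Real.log_two_lt_d9; linarith
    have h1 : 1 ≤ Real.exp c₂ * Real.exp (-(c₂ / 2 * Real.sqrt (Real.log N))) := by
      rw [← Real.exp_add]
      exact Real.one_le_exp (by nlinarith [Real.sqrt_nonneg (Real.log N)])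
    have hN0 : (0 : ℝ) ≤ N := Nat.cast_nonneg N
    calc (N : ℝ) = 1 * N * 1 := by ring
      _ ≤ (K' * (1 + Real.exp c₂) + 1) * N * (Real.exp c₂ * Real.exp (-(c₂ / 2 * Real.sqrt (Real.log N)))) := by
          apply mul_le_mul _ h1 zero_le_one (by positivity)
          exact mul_le_mul_of_nonneg_right (by nlinarith [Real.exp_pos c₂]) hN0
      _ = _ := by ring
  push Not at hN
  have hN0 : (0 : ℝ) < N := by exact_mod_cast (by omega : 0 < N)
  have hlogN : 0 ≤ Real.log N := Real.log_natCast_nonneg N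
  have ht2 : (2 : ℝ) ^ t ≤ Real.exp (c₂ * Real.sqrt (Real.log N)) :=
    ht.trans (Real.exp_le_exp.mpr (by nlinarith [Real.sqrt_nonneg (Real.log N)]))
  -- the case `t = 0`: `e(ax) = 1` and the trivial character mod `1`
  rcases Nat.eq_zero_or_pos t with rfl | htpos
  · haveI : Subsingleton (ZMod (2 ^ 0)) := ZMod.subsingleton_iff.mpr (pow_zero 2)
    have h1 := hK' 0 N 1 (by simpa using ht2)
    have e : ∑ x ∈ range N, ((μ x : ℝ) : ℂ) * (𝐞 ((a : ℝ) * x / (2 ^ 0 : ℕ)) : ℂ) =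
        ∑ x ∈ range N, ((μ x : ℝ) : ℂ) * (1 : DirichletCharacter ℂ (2 ^ 0)) (x : ZMod (2 ^ 0)) := by
      refine Finset.sum_congr rfl fun x _ => ?_
      rw [MulChar.one_apply (isUnit_of_subsingleton _), pow_zero, Nat.cast_one, div_one,
        show (a : ℝ) * x = ((a * x : ℤ) : ℝ) by push_cast; ring, fourierChar_intCast]
    rw [e]
    refine h1.trans ?_
    have hexp : Real.exp (-(c₂ * Real.sqrt (Real.log N))) ≤ Real.exp (-(c₂ / 2 * Real.sqrt (Real.log N))) :=
      Real.exp_le_exp.mpr (by nlinarith [Real.sqrt_nonneg (Real.log N)])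
    have hKle : K' ≤ (K' * (1 + Real.exp c₂) + 1) * Real.exp c₂ := by
      have h2 : K' * 1 ≤ K' * Real.exp c₂ := mul_le_mul_of_nonneg_left (Real.one_le_exp hc₂.le) hK'0
      nlinarith [Real.exp_pos c₂, hK'0]
    calc K' * N * Real.exp (-(c₂ * Real.sqrt (Real.log N)))
        ≤ K' * N * Real.exp (-(c₂ / 2 * Real.sqrt (Real.log N))) := by gcongr
      _ ≤ (K' * (1 + Real.exp c₂) + 1) * Real.exp c₂ * N * Real.exp (-(c₂ / 2 * Real.sqrt (Real.log N))) := by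
          gcongr
  -- the case `t ≥ 1`
  haveI : NeZero (2 ^ t) := ⟨pow_ne_zero t two_ne_zero⟩
  set q : ℕ := 2 ^ t with hq
  set N₂ : ℕ := (N + 1) / 2 with hN₂
  have hN₂N : N₂ ≤ N := by omega
  have hN₂2 : 2 ≤ N₂ := by omega
  have hN₂r : (N : ℝ) ≤ 2 * N₂ := by exact_mod_cast (by omega : N ≤ 2 * N₂)
  have hN₂1 : (1 : ℝ) ≤ N₂ := by exact_mod_cast (by omega : 1 ≤ N₂)
  -- hypothesis of Theorem 3 at level `N₂`: `√log N ≤ 2 √log N₂`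
  have hsqrt : Real.sqrt (Real.log N) ≤ 2 * Real.sqrt (Real.log N₂) := by
    have h4 : (N : ℝ) ≤ (N₂ : ℝ) ^ 4 := by
      have h2 : (2 : ℝ) ≤ N₂ := by exact_mod_cast hN₂2
      have h8 : (2 : ℝ) ^ 3 ≤ (N₂ : ℝ) ^ 3 := pow_le_pow_left₀ (by norm_num) h2 3
      norm_num at h8
      calc (N : ℝ) ≤ 2 * N₂ := hN₂r
        _ ≤ (N₂ : ℝ) ^ 3 * N₂ := by nlinarith
        _ = (N₂ : ℝ) ^ 4 := by ring
    have hlog : Real.log N ≤ 4 * Real.log N₂ := by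
      calc Real.log N ≤ Real.log ((N₂ : ℝ) ^ 4) := Real.log_le_log hN0 h4
        _ = 4 * Real.log N₂ := by rw [Real.log_pow]; norm_num
    calc Real.sqrt (Real.log N) ≤ Real.sqrt (4 * Real.log N₂) := Real.sqrt_le_sqrt hlog
      _ = 2 * Real.sqrt (Real.log N₂) := by
          rw [Real.sqrt_mul' _ (Real.log_nonneg hN₂1), show (4 : ℝ) = 2 ^ 2 by norm_num,
            Real.sqrt_sq (by norm_num)]
  have ht2' : (2 : ℝ) ^ t ≤ Real.exp (c₂ * Real.sqrt (Real.log N₂)) :=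
    ht.trans (Real.exp_le_exp.mpr (by nlinarith [hsqrt, Real.sqrt_nonneg (Real.log N₂)]))
  -- the two odd-restricted sums
  have hodd : ∀ (M : ℕ) (b : ℤ), (2 : ℝ) ^ t ≤ Real.exp (c₂ * Real.sqrt (Real.log M)) →
      ‖∑ x ∈ (range M).filter Odd, ((μ x : ℝ) : ℂ) * (𝐞 ((b : ℝ) * x / q) : ℂ)‖ ≤
        q * (K' * M * Real.exp (-(c₂ * Real.sqrt (Real.log M)))) := by
    intro M b hM
    rw [← filter_coprime_two_pow_eq htpos]
    exact norm_sum_coprime_fourierChar_le (q := q) (fun x => ((μ x : ℝ) : ℂ)) M b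
      (fun χ => hK' t M χ hM)
  have hS1 := hodd N a ht2
  have hS2 := hodd N₂ (2 * a) ht2'
  -- decomposition of the sum
  have hsplit : ∑ x ∈ range N, ((μ x : ℝ) : ℂ) * (𝐞 ((a : ℝ) * x / q) : ℂ) =
      ∑ x ∈ (range N).filter Odd, ((μ x : ℝ) : ℂ) * (𝐞 ((a : ℝ) * x / q) : ℂ) -
        ∑ y ∈ (range N₂).filter Odd, ((μ y : ℝ) : ℂ) * (𝐞 (((2 * a : ℤ) : ℝ) * y / q) : ℂ) := by
    rw [sum_range_eq_odd_add_even, sub_eq_add_neg, ← hN₂]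
    congr 1
    rw [Finset.sum_filter, ← Finset.sum_neg_distrib]
    refine Finset.sum_congr rfl fun y _ => ?_
    rw [moebius_two_mul]
    split_ifs with hy
    · push_cast; ring_nf
    · push_cast; ring
  have hq' : ((2 ^ t : ℕ) : ℝ) = (q : ℝ) := by rw [hq]
  simp only [hq'] at *
  rw [hsplit]
  have hqexp : (q : ℝ) ≤ Real.exp (c₂ / 2 * Real.sqrt (Real.log N)) := by
    rw [hq]; push_cast; exact ht
  -- bound the second piece at level `N`
  have hS2' : (q : ℝ) * (K' * N₂ * Real.exp (-(c₂ * Real.sqrt (Real.log N₂)))) ≤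
      q * (K' * N * (Real.exp c₂ * Real.exp (-(c₂ * Real.sqrt (Real.log N))))) := by
    have h1 := exp_neg_sqrt_log_le_of_le_two_mul hN0.le hN₂1 hN₂r hc₂.le
    have hN₂N' : (N₂ : ℝ) ≤ N := by exact_mod_cast hN₂N
    gcongr
  calc ‖∑ x ∈ (range N).filter Odd, ((μ x : ℝ) : ℂ) * (𝐞 ((a : ℝ) * x / q) : ℂ) -
        ∑ y ∈ (range N₂).filter Odd, ((μ y : ℝ) : ℂ) * (𝐞 (((2 * a : ℤ) : ℝ) * y / q) : ℂ)‖
      ≤ q * (K' * N * Real.exp (-(c₂ * Real.sqrt (Real.log N)))) +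
        q * (K' * N * (Real.exp c₂ * Real.exp (-(c₂ * Real.sqrt (Real.log N))))) :=
        (norm_sub_le _ _).trans (add_le_add hS1 (hS2.trans hS2'))
    _ = q * Real.exp (-(c₂ * Real.sqrt (Real.log N))) * (K' * (1 + Real.exp c₂)) * N := by ring
    _ ≤ Real.exp (c₂ / 2 * Real.sqrt (Real.log N)) * Real.exp (-(c₂ * Real.sqrt (Real.log N))) *
        (K' * (1 + Real.exp c₂)) * N := by gcongr
    _ = (K' * (1 + Real.exp c₂)) * N * Real.exp (-(c₂ / 2 * Real.sqrt (Real.log N))) := by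
        rw [← Real.exp_add]; ring_nf
    _ ≤ (K' * (1 + Real.exp c₂) + 1) * Real.exp c₂ * N * Real.exp (-(c₂ / 2 * Real.sqrt (Real.log N))) := by
        have hle : K' * (1 + Real.exp c₂) ≤ (K' * (1 + Real.exp c₂) + 1) * Real.exp c₂ :=
          calc K' * (1 + Real.exp c₂) = (K' * (1 + Real.exp c₂)) * 1 := (mul_one _).symm
            _ ≤ (K' * (1 + Real.exp c₂) + 1) * Real.exp c₂ :=
                mul_le_mul (by linarith) (Real.one_le_exp hc₂.le) zero_le_one (by positivity)
        have hrest : 0 ≤ (N : ℝ) * Real.exp (-(c₂ / 2 * Real.sqrt (Real.log N))) := by positivity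
        calc K' * (1 + Real.exp c₂) * N * Real.exp (-(c₂ / 2 * Real.sqrt (Real.log N)))
            = K' * (1 + Real.exp c₂) * (N * Real.exp (-(c₂ / 2 * Real.sqrt (Real.log N)))) := by ring
          _ ≤ (K' * (1 + Real.exp c₂) + 1) * Real.exp c₂ * (N * Real.exp (-(c₂ / 2 * Real.sqrt (Real.log N)))) :=
              mul_le_mul_of_nonneg_right hle hrest
          _ = _ := by ring

/-! ### From sums over `x < N` to `afExpSum`, and Corollary 1 for `λ` -/

/-- `∑_{1 ≤ d ≤ N} 1/d² ≤ 2`. [folklore] -/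
theorem sum_Icc_inv_sq_le_two (N : ℕ) : ∑ d ∈ Icc 1 N, 1 / ((d : ℝ) ^ 2) ≤ 2 := by
  have h := sum_Ioo_inv_sq_le (α := ℝ) 0 (N + 1)
  have hI : Finset.Ioo 0 (N + 1) = Icc 1 N := by
    ext d; simp only [Finset.mem_Ioo, Finset.mem_Icc]; omega
  rw [hI] at h
  simp only [Nat.cast_zero, zero_add, div_one] at h
  refine le_trans (le_of_eq (Finset.sum_congr rfl fun d _ => ?_)) h
  rw [one_div]

/-- `∑_{x < N+1} f(x) e(θx) = ∑_{1 ≤ n ≤ N} f(n) e(nθ)` when `f(0) = 0`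
(Kátai's `expSum` versus `Sieve.Vinogradov.afExpSum`). [folklore] -/
theorem expSum_succ_eq_afExpSum (f : ℕ → ℝ) (hf : f 0 = 0) (N : ℕ) (θ : ℝ) :
    expSum f (N + 1) θ = afExpSum f N θ := by
  unfold expSum afExpSum
  rw [Finset.range_eq_Ico, Finset.sum_eq_sum_Ico_succ_bot (Nat.succ_pos N), hf]
  simp only [Complex.ofReal_zero, zero_mul, zero_add]
  rw [show Finset.Ico 1 (N + 1) = Finset.Icc 1 N from rfl]
  refine Finset.sum_congr rfl fun x _ => ?_
  rw [mul_comm θ]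

/-- The `range` form of the Möbius sum in Corollary 1 is an `expSum`. [folklore] -/
theorem sum_range_moebius_eq_expSum (N t : ℕ) (a : ℤ) :
    ∑ x ∈ range N, ((μ x : ℝ) : ℂ) * (𝐞 ((a : ℝ) * x / (2 ^ t : ℕ)) : ℂ) =
      expSum (fun x => (μ x : ℝ)) N ((a : ℝ) / (2 ^ t : ℕ)) := by
  unfold expSum
  refine Finset.sum_congr rfl fun x _ => ?_
  congr 2; ring

/-- **Green 2012, Corollary 1 for the Liouville function** (from the Möbius case through
`λ = 𝟙_□ ⋆ μ`, the sums over `N/a²`-ranges with `a ≤ N^{1/4}` by `moebius_dyadic_expSum` and the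
others trivially): absolute `c > 0`, `K` with
`‖∑_{x<N} λ(x) e(ax/2^t)‖ ≤ K N e^{-c√log N}` for `2^t ≤ e^{c√log N}`; conditional on Theorem 3.
[cite: Green2012, Corollary 1 and §1 (remark on λ)] -/
theorem liouville_dyadic_expSum (hX : green_moebius_character_twoPower) :
    ∃ c : ℝ, 0 < c ∧ ∃ K : ℝ, 0 ≤ K ∧ ∀ (t N : ℕ) (a : ℤ),
      (2 : ℝ) ^ t ≤ Real.exp (c * Real.sqrt (Real.log N)) →
      ‖expSum (fun x => (liouville x : ℝ)) N ((a : ℝ) / (2 ^ t : ℕ))‖ ≤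
        K * N * Real.exp (-(c * Real.sqrt (Real.log N))) := by
  obtain ⟨c₃, hc₃, K₃, hK₃0, hK₃⟩ := moebius_dyadic_expSum hX
  set c : ℝ := c₃ / 2 with hc
  have hc0 : 0 < c := by positivity
  -- constants: `3K₃` for the long sums, `4 e^{c²·4}` for the tail `a > N^{1/4}`, `e^{c}` for `N ≤ 1`
  refine ⟨c, hc0, 6 * K₃ + 4 * Real.exp (c ^ 2 / (4 * (1 / 4))) + Real.exp c, by positivity,
    fun t N a ht => ?_⟩
  have hliou1 : ∀ x, |(fun x => (liouville x : ℝ)) x| ≤ 1 := fun x => LiouvilleSum.abs_liouville_le_one x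
  have htriv := norm_expSum_le hliou1 N ((a : ℝ) / (2 ^ t : ℕ))
  -- `N = 0`
  rcases Nat.eq_zero_or_pos N with rfl | hNpos
  · simp [expSum]
  obtain ⟨M, rfl⟩ : ∃ M, N = M + 1 := ⟨N - 1, by omega⟩
  have hN0 : (0 : ℝ) < (M + 1 : ℕ) := by positivity
  have hN1 : (1 : ℝ) ≤ (M + 1 : ℕ) := by exact_mod_cast (by omega : 1 ≤ M + 1)
  set u := Real.sqrt (Real.log (M + 1 : ℕ)) with hu
  have hu0 : 0 ≤ u := Real.sqrt_nonneg _
  have hE0 : 0 < Real.exp (-(c * u)) := Real.exp_pos _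
  -- rewrite as a sum over `b ≤ √M` of Möbius sums
  rw [expSum_succ_eq_afExpSum _ (by simp) M]
  have e1 : afExpSum (fun x => (liouville x : ℝ)) M ((a : ℝ) / (2 ^ t : ℕ)) =
      afExpSum (⇑(liouville : ArithmeticFunction ℝ)) M ((a : ℝ) / (2 ^ t : ℕ)) := by
    unfold afExpSum
    exact Finset.sum_congr rfl fun x _ => by rw [ArithmeticFunction.intCoe_apply]
  rw [e1, MoebiusExpSum.afExpSum_liouville_eq_sum_sqrt]
  refine (norm_sum_le _ _).trans ?_
  -- each Möbius sum, back in `range` form with numerator `a b²`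
  have e2 : ∀ b : ℕ, afExpSum (⇑(μ : ArithmeticFunction ℝ)) (M / (b * b)) ((a : ℝ) / (2 ^ t : ℕ) * (b * b : ℕ)) =
      ∑ x ∈ range (M / (b * b) + 1), ((μ x : ℝ) : ℂ) * (𝐞 (((a * (b * b : ℕ) : ℤ) : ℝ) * x / (2 ^ t : ℕ)) : ℂ) := by
    intro b
    rw [sum_range_moebius_eq_expSum, expSum_succ_eq_afExpSum _ (by simp)]
    unfold afExpSum
    refine Finset.sum_congr rfl fun x _ => ?_
    rw [ArithmeticFunction.intCoe_apply]
    congr 2; push_cast; ring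
  -- the bound for each `b`: long ranges via Corollary 1 for `μ`, short ones trivially
  have hterm : ∀ b ∈ Icc 1 (Nat.sqrt M),
      ‖afExpSum (⇑(μ : ArithmeticFunction ℝ)) (M / (b * b)) ((a : ℝ) / (2 ^ t : ℕ) * (b * b : ℕ))‖ ≤
        (if b ^ 4 ≤ M + 1 then 3 * K₃ * ((M + 1 : ℕ) : ℝ) * Real.exp (-(c * u)) * (1 / (b : ℝ) ^ 2)
          else 2 * ((M + 1 : ℕ) : ℝ) * (1 / (b : ℝ) ^ 2)) := by
    intro b hb
    have hb1 : 1 ≤ b := (Finset.mem_Icc.mp hb).1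
    have hbM : b * b ≤ M := Nat.le_sqrt.mp (Finset.mem_Icc.mp hb).2
    have hb0 : (0 : ℝ) < b := by exact_mod_cast hb1
    have hbb0 : 0 < b * b := Nat.mul_pos hb1 hb1
    set Mb : ℕ := M / (b * b) + 1 with hMb
    have hMb_le : (Mb : ℝ) ≤ (M + 1 : ℕ) / (b : ℝ) ^ 2 + 1 := by
      have : ((M / (b * b) : ℕ) : ℝ) ≤ M / (b * b : ℕ) := Nat.cast_div_le
      rw [hMb]; push_cast at this ⊢
      have hM1 : (M : ℝ) / (b * b) ≤ (M + 1) / (b : ℝ) ^ 2 := by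
        rw [sq]; exact div_le_div_of_nonneg_right (by linarith) (by positivity)
      linarith
    have hMb_le2 : (Mb : ℝ) ≤ 2 * ((M + 1 : ℕ) : ℝ) * (1 / (b : ℝ) ^ 2) := by
      -- `1 ≤ (M+1)/b²` since `b² ≤ M`
      have h1 : (1 : ℝ) ≤ ((M + 1 : ℕ) : ℝ) / (b : ℝ) ^ 2 := by
        rw [le_div_iff₀ (by positivity), one_mul]
        have : ((b * b : ℕ) : ℝ) ≤ M := by exact_mod_cast hbM
        push_cast at this ⊢; nlinarith
      calc (Mb : ℝ) ≤ (M + 1 : ℕ) / (b : ℝ) ^ 2 + 1 := hMb_le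
        _ ≤ (M + 1 : ℕ) / (b : ℝ) ^ 2 + (M + 1 : ℕ) / (b : ℝ) ^ 2 := by linarith
        _ = 2 * ((M + 1 : ℕ) : ℝ) * (1 / (b : ℝ) ^ 2) := by ring
    rw [e2 b]
    -- trivial bound `≤ Mb`
    have htrivb : ‖∑ x ∈ range Mb, ((μ x : ℝ) : ℂ) * (𝐞 (((a * (b * b : ℕ) : ℤ) : ℝ) * x / (2 ^ t : ℕ)) : ℂ)‖ ≤ Mb := by
      rw [sum_range_moebius_eq_expSum]
      exact norm_expSum_le (fun x => by exact_mod_cast ArithmeticFunction.abs_moebius_le_one) Mb _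
    split_ifs with hb4
    · -- long range: `Mb ≥ (M+1)/b² ≥ √(M+1)`, so `log Mb ≥ (1/2) log (M+1)`
      have hMb_ge : ((M + 1 : ℕ) : ℝ) / (b : ℝ) ^ 2 ≤ Mb := by
        -- `M < (M/(bb)) (bb) + bb` so `M + 1 ≤ Mb · b²`
        have h := Nat.lt_div_mul_add (a := M) hbb0
        rw [div_le_iff₀ (by positivity)]
        have h' : ((M + 1 : ℕ) : ℝ) ≤ ((M / (b * b) : ℕ) : ℝ) * (b * b : ℕ) + (b * b : ℕ) := by
          exact_mod_cast h
        rw [hMb]; push_cast at h' ⊢; nlinarith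
      have hMb1 : (1 : ℝ) ≤ Mb := by rw [hMb]; push_cast; linarith
      have hMb0 : (0 : ℝ) < Mb := by linarith
      have hlogMb : Real.log (M + 1 : ℕ) ≤ 2 * Real.log Mb := by
        -- `(M+1) ≤ ((M+1)/b²)² ≤ Mb²` as `b⁴ ≤ M+1`
        have h1 : ((M + 1 : ℕ) : ℝ) ≤ (((M + 1 : ℕ) : ℝ) / (b : ℝ) ^ 2) ^ 2 := by
          rw [div_pow, le_div_iff₀ (by positivity)]
          have : ((b : ℝ) ^ 2) ^ 2 = ((b ^ 4 : ℕ) : ℝ) := by push_cast; ring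
          rw [this]
          have hb4' : ((b ^ 4 : ℕ) : ℝ) ≤ (M + 1 : ℕ) := by exact_mod_cast hb4
          nlinarith
        have h2 : (((M + 1 : ℕ) : ℝ) / (b : ℝ) ^ 2) ^ 2 ≤ (Mb : ℝ) ^ 2 :=
          pow_le_pow_left₀ (by positivity) hMb_ge 2
        calc Real.log (M + 1 : ℕ) ≤ Real.log ((Mb : ℝ) ^ 2) := Real.log_le_log hN0 (h1.trans h2)
          _ = 2 * Real.log Mb := by rw [Real.log_pow]; norm_num
      have hsqrt : u ≤ 2 * Real.sqrt (Real.log Mb) := by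
        calc u ≤ Real.sqrt (2 * Real.log Mb) := Real.sqrt_le_sqrt hlogMb
          _ ≤ Real.sqrt (4 * Real.log Mb) := Real.sqrt_le_sqrt (by nlinarith [Real.log_nonneg hMb1])
          _ = 2 * Real.sqrt (Real.log Mb) := by
              rw [Real.sqrt_mul' _ (Real.log_nonneg hMb1), show (4 : ℝ) = 2 ^ 2 by norm_num,
                Real.sqrt_sq (by norm_num)]
      have htb : (2 : ℝ) ^ t ≤ Real.exp (c₃ * Real.sqrt (Real.log Mb)) :=
        ht.trans (Real.exp_le_exp.mpr (by rw [hc]; nlinarith [Real.sqrt_nonneg (Real.log Mb)]))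
      refine (hK₃ t Mb (a * (b * b : ℕ)) htb).trans ?_
      have hexp : Real.exp (-(c₃ * Real.sqrt (Real.log Mb))) ≤ Real.exp (-(c * u)) :=
        Real.exp_le_exp.mpr (by rw [hc]; nlinarith [Real.sqrt_nonneg (Real.log Mb)])
      have hx : 0 ≤ K₃ * ((M + 1 : ℕ) : ℝ) * Real.exp (-(c * u)) * (1 / (b : ℝ) ^ 2) := by positivity
      calc K₃ * Mb * Real.exp (-(c₃ * Real.sqrt (Real.log Mb)))
          ≤ K₃ * (2 * ((M + 1 : ℕ) : ℝ) * (1 / (b : ℝ) ^ 2)) * Real.exp (-(c * u)) := by gcongr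
        _ = 2 * (K₃ * ((M + 1 : ℕ) : ℝ) * Real.exp (-(c * u)) * (1 / (b : ℝ) ^ 2)) := by ring
        _ ≤ 3 * (K₃ * ((M + 1 : ℕ) : ℝ) * Real.exp (-(c * u)) * (1 / (b : ℝ) ^ 2)) := by linarith
        _ = 3 * K₃ * ((M + 1 : ℕ) : ℝ) * Real.exp (-(c * u)) * (1 / (b : ℝ) ^ 2) := by ring
    · exact htrivb.trans hMb_le2
  refine (Finset.sum_le_sum hterm).trans ?_
  -- sum the two kinds of terms
  rw [Finset.sum_ite]
  have hA : ∑ b ∈ (Icc 1 (Nat.sqrt M)).filter (fun b => b ^ 4 ≤ M + 1),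
      3 * K₃ * ((M + 1 : ℕ) : ℝ) * Real.exp (-(c * u)) * (1 / (b : ℝ) ^ 2) ≤
      3 * K₃ * ((M + 1 : ℕ) : ℝ) * Real.exp (-(c * u)) * 2 := by
    rw [← Finset.mul_sum]
    refine mul_le_mul_of_nonneg_left ?_ (by positivity)
    calc ∑ b ∈ (Icc 1 (Nat.sqrt M)).filter (fun b => b ^ 4 ≤ M + 1), 1 / (b : ℝ) ^ 2
        ≤ ∑ b ∈ Icc 1 (Nat.sqrt M), 1 / (b : ℝ) ^ 2 :=
          Finset.sum_le_sum_of_subset_of_nonneg (Finset.filter_subset _ _) fun _ _ _ => by positivity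
      _ ≤ 2 := sum_Icc_inv_sq_le_two _
  -- the tail `b⁴ > M + 1`: `∑ 1/b² ≤ 2/(B+1)` with `B = ⌊(M+1)^{1/4}⌋`, and `(M+1)/(B+1) ≤ (M+1)^{3/4}`
  set B : ℕ := ⌊((M + 1 : ℕ) : ℝ) ^ (1 / 4 : ℝ)⌋₊ with hB
  have hB4 : ∀ b : ℕ, 1 ≤ b → ¬ (b ^ 4 ≤ M + 1) → B < b := by
    intro b hb1 hb4
    push Not at hb4
    by_contra hle
    push Not at hle
    have h1 : (b : ℝ) ≤ ((M + 1 : ℕ) : ℝ) ^ (1 / 4 : ℝ) :=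
      le_trans (by exact_mod_cast hle) (Nat.floor_le (by positivity))
    have h2 : (b : ℝ) ^ 4 ≤ (((M + 1 : ℕ) : ℝ) ^ (1 / 4 : ℝ)) ^ 4 := pow_le_pow_left₀ (by positivity) h1 4
    have e : (((M + 1 : ℕ) : ℝ) ^ (1 / 4 : ℝ)) ^ 4 = ((M + 1 : ℕ) : ℝ) := by
      rw [← Real.rpow_natCast, ← Real.rpow_mul hN0.le]; norm_num
    rw [e] at h2
    have : ((b ^ 4 : ℕ) : ℝ) ≤ (M + 1 : ℕ) := by exact_mod_cast h2
    have := (Nat.cast_le (α := ℝ)).mp this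
    omega
  have hBtail : ∑ b ∈ (Icc 1 (Nat.sqrt M)).filter (fun b => ¬ b ^ 4 ≤ M + 1), 2 * ((M + 1 : ℕ) : ℝ) * (1 / (b : ℝ) ^ 2)
      ≤ 2 * ((M + 1 : ℕ) : ℝ) * (2 / ((B : ℝ) + 1)) := by
    rw [← Finset.mul_sum]
    refine mul_le_mul_of_nonneg_left ?_ (by positivity)
    have hsub : (Icc 1 (Nat.sqrt M)).filter (fun b => ¬ b ^ 4 ≤ M + 1) ⊆ Finset.Ioo B (Nat.sqrt M + 1) := by
      intro b hb
      rw [Finset.mem_filter, Finset.mem_Icc] at hb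
      rw [Finset.mem_Ioo]
      exact ⟨hB4 b hb.1.1 hb.2, by omega⟩
    calc ∑ b ∈ (Icc 1 (Nat.sqrt M)).filter (fun b => ¬ b ^ 4 ≤ M + 1), 1 / (b : ℝ) ^ 2
        ≤ ∑ b ∈ Finset.Ioo B (Nat.sqrt M + 1), 1 / (b : ℝ) ^ 2 :=
          Finset.sum_le_sum_of_subset_of_nonneg hsub fun _ _ _ => by positivity
      _ = ∑ b ∈ Finset.Ioo B (Nat.sqrt M + 1), ((b : ℝ) ^ 2)⁻¹ := Finset.sum_congr rfl fun b _ => one_div _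
      _ ≤ 2 / ((B : ℝ) + 1) := sum_Ioo_inv_sq_le B _
  have hB1 : ((M + 1 : ℕ) : ℝ) ^ (1 / 4 : ℝ) < (B : ℝ) + 1 := Nat.lt_floor_add_one _
  have htail : 2 * ((M + 1 : ℕ) : ℝ) * (2 / ((B : ℝ) + 1)) ≤ 4 * ((M + 1 : ℕ) : ℝ) ^ (1 - 1 / 4 : ℝ) := by
    have hq0 : 0 < ((M + 1 : ℕ) : ℝ) ^ (1 / 4 : ℝ) := by positivity
    calc 2 * ((M + 1 : ℕ) : ℝ) * (2 / ((B : ℝ) + 1)) = 4 * ((M + 1 : ℕ) : ℝ) / ((B : ℝ) + 1) := by ring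
      _ ≤ 4 * ((M + 1 : ℕ) : ℝ) / ((M + 1 : ℕ) : ℝ) ^ (1 / 4 : ℝ) :=
          div_le_div_of_nonneg_left (by positivity) hq0 hB1.le
      _ = 4 * ((M + 1 : ℕ) : ℝ) ^ (1 - 1 / 4 : ℝ) := by
          rw [Real.rpow_sub hN0, Real.rpow_one]; ring
  have hpoly := rpow_le_mul_exp_neg_sqrt_log hN1 c (by norm_num : (0 : ℝ) < 1 / 4)
  -- assemble
  calc ∑ b ∈ (Icc 1 (Nat.sqrt M)).filter (fun b => b ^ 4 ≤ M + 1),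
        3 * K₃ * ((M + 1 : ℕ) : ℝ) * Real.exp (-(c * u)) * (1 / (b : ℝ) ^ 2) +
      ∑ b ∈ (Icc 1 (Nat.sqrt M)).filter (fun b => ¬ b ^ 4 ≤ M + 1), 2 * ((M + 1 : ℕ) : ℝ) * (1 / (b : ℝ) ^ 2)
      ≤ 3 * K₃ * ((M + 1 : ℕ) : ℝ) * Real.exp (-(c * u)) * 2 + 4 * ((M + 1 : ℕ) : ℝ) ^ (1 - 1 / 4 : ℝ) :=
        add_le_add hA (hBtail.trans htail)
    _ ≤ 3 * K₃ * ((M + 1 : ℕ) : ℝ) * Real.exp (-(c * u)) * 2 +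
        4 * (Real.exp (c ^ 2 / (4 * (1 / 4))) * (M + 1 : ℕ) * Real.exp (-(c * u))) := by gcongr
    _ = (6 * K₃ + 4 * Real.exp (c ^ 2 / (4 * (1 / 4)))) * (M + 1 : ℕ) * Real.exp (-(c * u)) := by ring
    _ ≤ (6 * K₃ + 4 * Real.exp (c ^ 2 / (4 * (1 / 4))) + Real.exp c) * (M + 1 : ℕ) * Real.exp (-(c * u)) := by
        apply mul_le_mul_of_nonneg_right _ (Real.exp_pos _).le
        apply mul_le_mul_of_nonneg_right _ (Nat.cast_nonneg _)
        linarith [Real.exp_pos c]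

/-! ### Green's Corollary 2 for `λ`: near a dyadic rational (partial summation) -/

/-- `‖e(s) - e(t)‖ ≤ 2π|s - t|`. [folklore] -/
theorem norm_fourierChar_sub_le (s t : ℝ) : ‖(𝐞 s : ℂ) - (𝐞 t : ℂ)‖ ≤ 2 * Real.pi * |s - t| := by
  have h1 : (𝐞 s : ℂ) - (𝐞 t : ℂ) = (𝐞 t : ℂ) * ((𝐞 (s - t) : ℂ) - 1) := by
    rw [mul_sub, ← fourierChar_add, mul_one]; congr 2; ring
  rw [h1, norm_mul, Literature.NumberTheory.Sieve.Vinogradov.norm_fourierChar, one_mul,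
    Literature.NumberTheory.Sieve.Vinogradov.norm_fourierChar_sub_one]
  calc 2 * |Real.sin (Real.pi * (s - t))| ≤ 2 * |Real.pi * (s - t)| := by
        linarith [Real.abs_sin_le_abs (x := Real.pi * (s - t))]
    _ = 2 * Real.pi * |s - t| := by rw [abs_mul, abs_of_pos Real.pi_pos]; ring

/-- **Partial summation against a slowly varying phase**: with `A(M) = ∑_{x<M} f(x)e(αx)`,
`‖∑_{x<N} f(x) e((α+η)x)‖ ≤ ‖A(N)‖ + 2π|η| ∑_{M=1}^{N-1} ‖A(M)‖`. [folklore] -/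
theorem norm_expSum_add_le (f : ℕ → ℝ) (N : ℕ) (α η : ℝ) :
    ‖expSum f N (α + η)‖ ≤ ‖expSum f N α‖ +
      2 * Real.pi * |η| * ∑ i ∈ range (N - 1), ‖expSum f (i + 1) α‖ := by
  have key : expSum f N (α + η) = ∑ i ∈ range N, (𝐞 (η * i) : ℂ) • ((f i : ℂ) * (𝐞 (α * i) : ℂ)) := by
    unfold expSum
    refine Finset.sum_congr rfl fun i _ => ?_
    rw [smul_eq_mul, show (α + η) * i = η * i + α * i by ring, fourierChar_add]; ring
  rw [key, Finset.sum_range_by_parts]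
  have hG : ∀ k, ∑ j ∈ range k, (f j : ℂ) * (𝐞 (α * j) : ℂ) = expSum f k α := fun k => rfl
  simp only [hG]
  refine (norm_sub_le _ _).trans (add_le_add ?_ ?_)
  · rw [norm_smul, Literature.NumberTheory.Sieve.Vinogradov.norm_fourierChar, one_mul]
  · refine (norm_sum_le _ _).trans ?_
    rw [Finset.mul_sum]
    refine Finset.sum_le_sum fun i _ => ?_
    rw [norm_smul]
    refine mul_le_mul_of_nonneg_right ?_ (norm_nonneg _)
    refine (norm_fourierChar_sub_le _ _).trans (le_of_eq ?_)
    rw [show η * ((i + 1 : ℕ) : ℝ) - η * (i : ℕ) = η by push_cast; ring]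

/-- **Green 2012, Corollary 2 for the Liouville function** ("a further standard deduction,
allowing us to bound `λ̂(θ)` when `θ` is near a dyadic rational"): absolute `c₄ > 0`, `K₄` with
`‖∑_{x<N} λ(x) e(θx)‖ ≤ K₄ N e^{-c₄√log N}` whenever `|θ - a/2^t| ≤ e^{c₄√log N}/N` and
`2^t ≤ e^{c₄√log N}`. (Green uses blocks of length `L`; we use the equivalent partial summation,
prefixes shorter than `N^{9/16}` being estimated trivially.) Conditional on Theorem 3.
[cite: Green2012, Corollary 2 and §1 (remark on λ)] -/
theorem liouville_near_dyadic (hX : green_moebius_character_twoPower) :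
    ∃ c₄ : ℝ, 0 < c₄ ∧ ∃ K₄ : ℝ, 0 ≤ K₄ ∧ ∀ (t N : ℕ) (a : ℤ) (θ : ℝ),
      (2 : ℝ) ^ t ≤ Real.exp (c₄ * Real.sqrt (Real.log N)) →
      |θ - (a : ℝ) / (2 ^ t : ℕ)| ≤ Real.exp (c₄ * Real.sqrt (Real.log N)) / N →
      ‖expSum (fun x => (liouville x : ℝ)) N θ‖ ≤ K₄ * N * Real.exp (-(c₄ * Real.sqrt (Real.log N))) := by
  obtain ⟨c, hc, K, hK0, hK⟩ := liouville_dyadic_expSum hX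
  set c₄ : ℝ := c / 4 with hc₄
  have hc₄0 : 0 < c₄ := by positivity
  set A : ℝ := (2 * c₄) ^ 2 / (4 * (7 / 8)) with hA
  refine ⟨c₄, hc₄0, K + 2 * Real.pi * K + 2 * Real.pi * Real.exp A, by positivity,
    fun t N a θ ht hθ => ?_⟩
  have hliou1 : ∀ x, |(fun x => (liouville x : ℝ)) x| ≤ 1 := fun x => LiouvilleSum.abs_liouville_le_one x
  rcases Nat.eq_zero_or_pos N with rfl | hNpos
  · simp [expSum]
  have hN0 : (0 : ℝ) < N := by exact_mod_cast hNpos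
  have hN1 : (1 : ℝ) ≤ N := by exact_mod_cast hNpos
  set u := Real.sqrt (Real.log N) with hu
  have hu0 : 0 ≤ u := Real.sqrt_nonneg _
  have hlogN : 0 ≤ Real.log N := Real.log_nonneg hN1
  set α : ℝ := (a : ℝ) / (2 ^ t : ℕ) with hα
  set η : ℝ := θ - α with hη
  have hθ' : θ = α + η := by rw [hη]; ring
  rw [hθ']
  refine (norm_expSum_add_le _ N α η).trans ?_
  -- prefix bounds
  have hpre : ∀ M : ℕ, M ≤ N → N ^ 9 ≤ M ^ 16 →
      ‖expSum (fun x => (liouville x : ℝ)) M α‖ ≤ K * N * Real.exp (-(3 * c / 4 * u)) := by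
    intro M hMN hM
    have hM0 : 0 < M := by
      rcases Nat.eq_zero_or_pos M with rfl | h
      · rw [zero_pow (by norm_num)] at hM
        have : 0 < N ^ 9 := Nat.pow_pos hNpos
        omega
      · exact h
    have hM0' : (0 : ℝ) < M := by exact_mod_cast hM0
    have hM1 : (1 : ℝ) ≤ M := by exact_mod_cast hM0
    -- `9 log N ≤ 16 log M`
    have hlog : 9 * Real.log N ≤ 16 * Real.log M := by
      have e9 : Real.log ((N : ℝ) ^ 9) = 9 * Real.log N := by rw [Real.log_pow]; norm_num
      have e16 : Real.log ((M : ℝ) ^ 16) = 16 * Real.log M := by rw [Real.log_pow]; norm_num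
      rw [← e9, ← e16]
      exact Real.log_le_log (by positivity) (by exact_mod_cast hM)
    have hsq1 : u ≤ 4 * Real.sqrt (Real.log M) := by
      calc u ≤ Real.sqrt (16 * Real.log M) := Real.sqrt_le_sqrt (by linarith)
        _ = 4 * Real.sqrt (Real.log M) := by
            rw [Real.sqrt_mul' _ (Real.log_nonneg hM1), show (16 : ℝ) = 4 ^ 2 by norm_num,
              Real.sqrt_sq (by norm_num)]
    have hsq2 : 3 * u ≤ 4 * Real.sqrt (Real.log M) := by
      calc 3 * u = Real.sqrt (9 * Real.log N) := by
            rw [Real.sqrt_mul' _ hlogN, show (9 : ℝ) = 3 ^ 2 by norm_num, Real.sqrt_sq (by norm_num)]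
        _ ≤ Real.sqrt (16 * Real.log M) := Real.sqrt_le_sqrt hlog
        _ = 4 * Real.sqrt (Real.log M) := by
            rw [Real.sqrt_mul' _ (Real.log_nonneg hM1), show (16 : ℝ) = 4 ^ 2 by norm_num,
              Real.sqrt_sq (by norm_num)]
    have htM : (2 : ℝ) ^ t ≤ Real.exp (c * Real.sqrt (Real.log M)) :=
      ht.trans (Real.exp_le_exp.mpr (by rw [hc₄]; nlinarith [Real.sqrt_nonneg (Real.log M)]))
    refine (hK t M a htM).trans ?_
    have hMN' : (M : ℝ) ≤ N := by exact_mod_cast hMN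
    have hexp : Real.exp (-(c * Real.sqrt (Real.log M))) ≤ Real.exp (-(3 * c / 4 * u)) :=
      Real.exp_le_exp.mpr (by nlinarith [Real.sqrt_nonneg (Real.log M)])
    gcongr
  -- the last prefix `A(N)`
  have hAN : ‖expSum (fun x => (liouville x : ℝ)) N α‖ ≤ K * N * Real.exp (-(c₄ * u)) := by
    have htN : (2 : ℝ) ^ t ≤ Real.exp (c * Real.sqrt (Real.log N)) :=
      ht.trans (Real.exp_le_exp.mpr (by rw [hc₄]; nlinarith))
    refine (hK t N a htN).trans ?_
    gcongr
    · rw [hc₄]; nlinarith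
  -- the sum of the prefixes
  set M₀ : ℕ := ⌊(N : ℝ) ^ (9 / 16 : ℝ)⌋₊ with hM₀
  have hM₀le : (M₀ : ℝ) ≤ (N : ℝ) ^ (9 / 16 : ℝ) := Nat.floor_le (by positivity)
  have hsum : ∑ i ∈ range (N - 1), ‖expSum (fun x => (liouville x : ℝ)) (i + 1) α‖ ≤
      N * (K * N * Real.exp (-(3 * c / 4 * u))) + (N : ℝ) ^ (9 / 8 : ℝ) := by
    have hsplit : ∀ i ∈ range (N - 1), ‖expSum (fun x => (liouville x : ℝ)) (i + 1) α‖ ≤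
        K * N * Real.exp (-(3 * c / 4 * u)) + (if (i + 1) ^ 16 < N ^ 9 then ((i + 1 : ℕ) : ℝ) else 0) := by
      intro i hi
      have hiN : i + 1 ≤ N := by have := Finset.mem_range.mp hi; omega
      split_ifs with hsmall
      · have := norm_expSum_le hliou1 (i + 1) α
        have h0 : 0 ≤ K * N * Real.exp (-(3 * c / 4 * u)) := by positivity
        linarith
      · push Not at hsmall
        have := hpre (i + 1) hiN hsmall
        linarith
    refine (Finset.sum_le_sum hsplit).trans ?_
    rw [Finset.sum_add_distrib, Finset.sum_const, Finset.card_range, nsmul_eq_mul, ← Finset.sum_filter]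
    refine add_le_add ?_ ?_
    · have : ((N - 1 : ℕ) : ℝ) ≤ N := by exact_mod_cast Nat.sub_le N 1
      exact mul_le_mul_of_nonneg_right this (by positivity)
    · -- the small prefixes: `i + 1 ≤ M₀`, at most `M₀` of them
      have hsub : (range (N - 1)).filter (fun i => (i + 1) ^ 16 < N ^ 9) ⊆ range M₀ := by
        intro i hi
        rw [Finset.mem_filter] at hi
        rw [Finset.mem_range]
        have h1 : (((i + 1 : ℕ) : ℝ)) ^ 16 < (N : ℝ) ^ 9 := by exact_mod_cast hi.2
        have h2 : ((i + 1 : ℕ) : ℝ) < (N : ℝ) ^ (9 / 16 : ℝ) := by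
          have h3 := Real.rpow_lt_rpow (by positivity) h1 (by norm_num : (0 : ℝ) < ((16 : ℕ) : ℝ)⁻¹)
          rw [Real.pow_rpow_inv_natCast (by positivity) (by norm_num), ← Real.rpow_natCast,
            ← Real.rpow_mul hN0.le] at h3
          norm_num at h3
          exact_mod_cast h3
        have h4 : i + 1 ≤ M₀ := Nat.le_floor h2.le
        omega
      calc ∑ i ∈ (range (N - 1)).filter (fun i => (i + 1) ^ 16 < N ^ 9), ((i + 1 : ℕ) : ℝ)
          ≤ ∑ i ∈ range M₀, ((i + 1 : ℕ) : ℝ) :=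
            Finset.sum_le_sum_of_subset_of_nonneg hsub fun _ _ _ => by positivity
        _ ≤ ∑ _i ∈ range M₀, (M₀ : ℝ) := Finset.sum_le_sum fun i hi => by
            exact_mod_cast Nat.succ_le_of_lt (Finset.mem_range.mp hi)
        _ = (M₀ : ℝ) ^ 2 := by rw [Finset.sum_const, Finset.card_range, nsmul_eq_mul, sq]
        _ ≤ ((N : ℝ) ^ (9 / 16 : ℝ)) ^ 2 := pow_le_pow_left₀ (Nat.cast_nonneg _) hM₀le 2
        _ = (N : ℝ) ^ (9 / 8 : ℝ) := by
            rw [← Real.rpow_natCast, ← Real.rpow_mul hN0.le]; norm_num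
  -- `|η| ≤ Q/N`
  have hηQ : |η| ≤ Real.exp (c₄ * u) / N := by rw [hη, hα]; exact hθ
  have hpoly := rpow_le_mul_exp_neg_sqrt_log hN1 (2 * c₄) (by norm_num : (0 : ℝ) < 7 / 8)
  have hπ0 : 0 < Real.pi := Real.pi_pos
  -- assemble
  have hpoly' : (N : ℝ) ^ (1 - 7 / 8 : ℝ) ≤ Real.exp A * N * Real.exp (-(2 * c₄ * u)) := by
    rw [hA, hu]; exact hpoly
  have hee : Real.exp (c₄ * u) * Real.exp (-(2 * c₄ * u)) = Real.exp (-(c₄ * u)) := by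
    rw [← Real.exp_add]; congr 1; ring
  calc ‖expSum (fun x => (liouville x : ℝ)) N α‖ +
        2 * Real.pi * |η| * ∑ i ∈ range (N - 1), ‖expSum (fun x => (liouville x : ℝ)) (i + 1) α‖
      ≤ K * N * Real.exp (-(c₄ * u)) + 2 * Real.pi * (Real.exp (c₄ * u) / N) *
          (N * (K * N * Real.exp (-(3 * c / 4 * u))) + (N : ℝ) ^ (9 / 8 : ℝ)) := by
        gcongr
    _ = K * N * Real.exp (-(c₄ * u)) + 2 * Real.pi * K * N * (Real.exp (c₄ * u) * Real.exp (-(3 * c / 4 * u))) +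
          2 * Real.pi * (Real.exp (c₄ * u) * ((N : ℝ) ^ (9 / 8 : ℝ) / N)) := by
        field_simp; ring
    _ ≤ K * N * Real.exp (-(c₄ * u)) + 2 * Real.pi * K * N * Real.exp (-(c₄ * u)) +
          2 * Real.pi * (Real.exp (c₄ * u) * (Real.exp A * N * Real.exp (-(2 * c₄ * u)))) := by
        gcongr
        · rw [← Real.exp_add]; exact Real.exp_le_exp.mpr (by rw [hc₄]; nlinarith)
        · -- `N^{9/8}/N = N^{1/8} ≤ e^A N e^{-2c₄u}`
          rw [div_le_iff₀ hN0]
          have e : (N : ℝ) ^ (9 / 8 : ℝ) = (N : ℝ) ^ (1 - 7 / 8 : ℝ) * N := by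
            rw [show (9 / 8 : ℝ) = (1 - 7 / 8) + 1 by norm_num, Real.rpow_add hN0, Real.rpow_one]
          rw [e]
          exact mul_le_mul_of_nonneg_right hpoly' hN0.le
    _ = (K + 2 * Real.pi * K) * N * Real.exp (-(c₄ * u)) +
          2 * Real.pi * Real.exp A * N * (Real.exp (c₄ * u) * Real.exp (-(2 * c₄ * u))) := by ring
    _ = (K + 2 * Real.pi * K + 2 * Real.pi * Real.exp A) * N * Real.exp (-(c₄ * u)) := by
        rw [hee]; ring

/-! ### Green's Lemma 1 (Harman–Kátai): the denominator must be a power of two -/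

/-- A geometric tail over digit positions: `∑_{i < n, v ≤ i+1} 2^{-(i+1)} ≤ 2 · 2^{-v}`. [folklore] -/
theorem sum_fin_half_pow_le (n v : ℕ) :
    ∑ i : Fin n, (if v ≤ (i : ℕ) + 1 then (1 / 2 : ℝ) ^ ((i : ℕ) + 1) else 0) ≤ 2 * (1 / 2 : ℝ) ^ v := by
  have h1 : ∑ i : Fin n, (if v ≤ (i : ℕ) + 1 then (1 / 2 : ℝ) ^ ((i : ℕ) + 1) else 0) =
      ∑ j ∈ range n, (if v ≤ j + 1 then (1 / 2 : ℝ) ^ (j + 1) else 0) :=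
    Fin.sum_univ_eq_sum_range (fun j => if v ≤ j + 1 then (1 / 2 : ℝ) ^ (j + 1) else 0) n
  rw [h1, ← Finset.sum_filter]
  -- reindex `e = j + 1` into `Ico v (n + 1)` and use the geometric series
  have hinj : ∀ x ∈ (range n).filter (fun j => v ≤ j + 1), ∀ y ∈ (range n).filter (fun j => v ≤ j + 1),
      x + 1 = y + 1 → x = y := fun x _ y _ h => by omega
  have h2 : ∑ j ∈ (range n).filter (fun j => v ≤ j + 1), (1 / 2 : ℝ) ^ (j + 1) =
      ∑ e ∈ ((range n).filter (fun j => v ≤ j + 1)).image (fun j => j + 1), (1 / 2 : ℝ) ^ e :=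
    (Finset.sum_image hinj).symm
  have hsub : ((range n).filter (fun j => v ≤ j + 1)).image (fun j => j + 1) ⊆ Finset.Ico v (n + 1) := by
    intro e he
    rw [Finset.mem_image] at he
    obtain ⟨j, hj, rfl⟩ := he
    rw [Finset.mem_filter, Finset.mem_range] at hj
    rw [Finset.mem_Ico]; omega
  have h3 := geom_sum_Ico_le_of_lt_one (m := v) (n := n + 1) (by norm_num : (0 : ℝ) ≤ 1 / 2)
    (by norm_num : (1 / 2 : ℝ) < 1)
  calc ∑ j ∈ (range n).filter (fun j => v ≤ j + 1), (1 / 2 : ℝ) ^ (j + 1)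
      = ∑ e ∈ ((range n).filter (fun j => v ≤ j + 1)).image (fun j => j + 1), (1 / 2 : ℝ) ^ e := h2
    _ ≤ ∑ e ∈ Finset.Ico v (n + 1), (1 / 2 : ℝ) ^ e :=
        Finset.sum_le_sum_of_subset_of_nonneg hsub fun _ _ _ => by positivity
    _ ≤ (1 / 2 : ℝ) ^ v / (1 - 1 / 2) := h3
    _ = 2 * (1 / 2 : ℝ) ^ v := by ring

/-- **Green 2012, Lemma 1** (the observation of Harman and Kátai): let
`θ = Σ_i r_i/2^{i+1}` be a sparse dyadic rational with `k` nonzero numerators, all `|r_i| ≤ Q`,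
and suppose `|θ - a/q| ≤ Q/2ⁿ` with `q ≤ Q`, `(a, q) = 1`, and `2^{⌊n/(k+1)⌋} > 4Q²`. Then `q` is a
power of two. (Pigeonhole gives a window of `⌊n/(k+1)⌋` consecutive positions free of nonzero
digits of `θ`; cutting `θ` there exhibits a dyadic `a'/2^u` with
`|a/q - a'/2^u| < 1/(qQ·) ≤ 1/(q 2^u)`, forcing `a/q = a'/2^u`.) [cite: Green2012, Lemma 1] -/
theorem harmanKatai {n : ℕ} (r : Fin n → ℤ) {Q : ℝ} (hQ : 1 ≤ Q) (hr : ∀ i, |(r i : ℝ)| ≤ Q)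
    {q : ℕ} (hq : 1 ≤ q) (hqQ : (q : ℝ) ≤ Q) {a : ℤ} (hcop : IsCoprime a (q : ℤ))
    (hθ : |dyadic r - a / q| ≤ Q / 2 ^ n)
    (hgap : 4 * Q ^ 2 < (2 : ℝ) ^ (n / ((Finset.univ.filter (fun i => r i ≠ 0)).card + 1))) :
    ∃ t : ℕ, t ≤ n ∧ q = 2 ^ t := by
  classical
  set S := Finset.univ.filter (fun i : Fin n => r i ≠ 0) with hS
  set k := S.card with hk
  set g := n / (k + 1) with hg
  have hkg : (k + 1) * g ≤ n := by rw [hg, mul_comm]; exact Nat.div_mul_le_self n (k + 1)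
  -- `g ≥ 1` (else `2^0 = 1 < 4Q²`)
  have hg1 : 1 ≤ g := by
    by_contra h0
    push Not at h0
    have : g = 0 := Nat.lt_one_iff.mp h0
    rw [this, pow_zero] at hgap
    nlinarith
  -- Step 1: a free window `(u, u+g)` with `u = m g`, `m ≤ k`
  obtain ⟨m, hm, hmB⟩ : ∃ m ∈ range (k + 1), m ∉ S.image (fun i : Fin n => ((i : ℕ) + 1) / g) := by
    by_contra hcon
    push Not at hcon
    have hsub : range (k + 1) ⊆ S.image (fun i : Fin n => ((i : ℕ) + 1) / g) := fun m hm => hcon m hm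
    have h1 := Finset.card_le_card hsub
    have h2 := Finset.card_image_le (s := S) (f := fun i : Fin n => ((i : ℕ) + 1) / g)
    rw [Finset.card_range] at h1
    omega
  have hmk : m ≤ k := by have := Finset.mem_range.mp hm; omega
  set u := m * g with hu
  have hug : u + g ≤ n := by
    calc u + g = (m + 1) * g := by rw [hu]; ring
      _ ≤ (k + 1) * g := Nat.mul_le_mul_right g (by omega)
      _ ≤ n := hkg
  have hfree : ∀ i : Fin n, r i ≠ 0 → ((i : ℕ) + 1 ≤ u ∨ u + g ≤ (i : ℕ) + 1) := by
    intro i hi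
    by_contra hcon
    push Not at hcon
    apply hmB
    rw [Finset.mem_image]
    refine ⟨i, Finset.mem_filter.mpr ⟨Finset.mem_univ _, hi⟩, ?_⟩
    have h1 := hcon.1
    have h2 := hcon.2
    rw [hu] at h1 h2
    exact Nat.div_eq_of_lt_le (by omega) (by rw [Nat.succ_mul]; omega)
  -- Step 2: cut `θ` at `u`: `θ = a'/2^u + tail`, `|tail| ≤ 2Q/2^{u+g}`
  set a' : ℤ := ∑ i ∈ Finset.univ.filter (fun i : Fin n => (i : ℕ) + 1 ≤ u), r i * 2 ^ (u - ((i : ℕ) + 1))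
    with ha'
  have hhead : ∑ i ∈ Finset.univ.filter (fun i : Fin n => (i : ℕ) + 1 ≤ u), (r i : ℝ) / 2 ^ ((i : ℕ) + 1) =
      (a' : ℝ) / 2 ^ u := by
    rw [ha']; push_cast
    rw [Finset.sum_div]
    refine Finset.sum_congr rfl fun i hi => ?_
    have hi' : (i : ℕ) + 1 ≤ u := (Finset.mem_filter.mp hi).2
    rw [div_eq_div_iff (by positivity) (by positivity), mul_assoc, ← pow_add, Nat.sub_add_cancel hi']
  have htail : |∑ i ∈ Finset.univ.filter (fun i : Fin n => ¬ ((i : ℕ) + 1 ≤ u)), (r i : ℝ) / 2 ^ ((i : ℕ) + 1)|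
      ≤ Q * (2 * (1 / 2 : ℝ) ^ (u + g)) := by
    refine (Finset.abs_sum_le_sum_abs _ _).trans ?_
    calc ∑ i ∈ Finset.univ.filter (fun i : Fin n => ¬ ((i : ℕ) + 1 ≤ u)), |(r i : ℝ) / 2 ^ ((i : ℕ) + 1)|
        ≤ ∑ i ∈ Finset.univ.filter (fun i : Fin n => ¬ ((i : ℕ) + 1 ≤ u)),
            Q * (if u + g ≤ (i : ℕ) + 1 then (1 / 2 : ℝ) ^ ((i : ℕ) + 1) else 0) := by
          refine Finset.sum_le_sum fun i hi => ?_
          have hiu : ¬ ((i : ℕ) + 1 ≤ u) := (Finset.mem_filter.mp hi).2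
          by_cases hri : r i = 0
          · rw [hri, Int.cast_zero, zero_div, abs_zero]; positivity
          · rcases hfree i hri with h | h
            · exact absurd h hiu
            · rw [if_pos h, abs_div, abs_of_pos (by positivity : (0 : ℝ) < 2 ^ ((i : ℕ) + 1)), one_div_pow,
                ← div_eq_mul_one_div]
              exact div_le_div_of_nonneg_right (hr i) (by positivity)
      _ ≤ ∑ i : Fin n, Q * (if u + g ≤ (i : ℕ) + 1 then (1 / 2 : ℝ) ^ ((i : ℕ) + 1) else 0) :=
          Finset.sum_le_sum_of_subset_of_nonneg (Finset.filter_subset _ _) fun i _ _ => by positivity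
      _ = Q * ∑ i : Fin n, (if u + g ≤ (i : ℕ) + 1 then (1 / 2 : ℝ) ^ ((i : ℕ) + 1) else 0) := by
          rw [Finset.mul_sum]
      _ ≤ Q * (2 * (1 / 2 : ℝ) ^ (u + g)) :=
          mul_le_mul_of_nonneg_left (sum_fin_half_pow_le n (u + g)) (by linarith)
  have hθsplit : dyadic r = (a' : ℝ) / 2 ^ u +
      ∑ i ∈ Finset.univ.filter (fun i : Fin n => ¬ ((i : ℕ) + 1 ≤ u)), (r i : ℝ) / 2 ^ ((i : ℕ) + 1) := by
    rw [dyadic, ← hhead, Finset.sum_filter_add_sum_filter_not]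
  -- Step 3: `|a/q - a'/2^u| < 1/(q 2^u)`, hence `a 2^u = a' q`
  have hpow : (2 : ℝ) ^ (u + g) = 2 ^ u * 2 ^ g := pow_add _ _ _
  have h2g : 4 * Q ^ 2 < (2 : ℝ) ^ g := by rw [hg]; exact hgap
  have h2u : (0 : ℝ) < 2 ^ u := by positivity
  have hq0 : (0 : ℝ) < q := by exact_mod_cast hq
  have h1 : |(a : ℝ) / q - (a' : ℝ) / 2 ^ u| ≤ Q / 2 ^ n + Q * (2 * (1 / 2 : ℝ) ^ (u + g)) := by
    calc |(a : ℝ) / q - (a' : ℝ) / 2 ^ u| = |(dyadic r - (a' : ℝ) / 2 ^ u) - (dyadic r - a / q)| := by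
          congr 1; ring
      _ ≤ |dyadic r - (a' : ℝ) / 2 ^ u| + |dyadic r - a / q| := abs_sub _ _
      _ ≤ Q * (2 * (1 / 2 : ℝ) ^ (u + g)) + Q / 2 ^ n := by
          refine add_le_add ?_ hθ
          rw [hθsplit, add_sub_cancel_left]; exact htail
      _ = _ := add_comm _ _
  have h3 : Q / 2 ^ n + Q * (2 * (1 / 2 : ℝ) ^ (u + g)) ≤ 3 * Q / (2 ^ u * 2 ^ g) := by
    have hn : Q / 2 ^ n ≤ Q / (2 ^ u * 2 ^ g) := by
      rw [← hpow]
      exact div_le_div_of_nonneg_left (by linarith) (by positivity) (pow_le_pow_right₀ (by norm_num) hug)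
    have e : Q * (2 * (1 / 2 : ℝ) ^ (u + g)) = 2 * Q / (2 ^ u * 2 ^ g) := by
      rw [one_div_pow, hpow]; ring
    have e2 : 3 * Q / (2 ^ u * 2 ^ g) = Q / (2 ^ u * 2 ^ g) + 2 * Q / (2 ^ u * 2 ^ g) := by ring
    rw [e, e2]
    linarith
  have h4 : 3 * Q / (2 ^ u * 2 ^ g) < 1 / ((q : ℝ) * 2 ^ u) := by
    rw [div_lt_div_iff₀ (by positivity) (by positivity)]
    have h5 : 3 * Q * q < (2 : ℝ) ^ g := by
      have h6 : 3 * Q * q ≤ 3 * Q * Q := mul_le_mul_of_nonneg_left hqQ (by linarith)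
      have e : 3 * Q * Q = 4 * Q ^ 2 - Q ^ 2 := by ring
      nlinarith
    calc 3 * Q * ((q : ℝ) * 2 ^ u) = 2 ^ u * (3 * Q * q) := by ring
      _ < 2 ^ u * 2 ^ g := mul_lt_mul_of_pos_left h5 h2u
      _ = 1 * (2 ^ u * 2 ^ g) := by ring
  have hdiff : |(a : ℝ) / q - (a' : ℝ) / 2 ^ u| < 1 / ((q : ℝ) * 2 ^ u) :=
    lt_of_le_of_lt h1 (lt_of_le_of_lt h3 h4)
  have hz : a * 2 ^ u = a' * q := by
    have e : (a : ℝ) / q - (a' : ℝ) / 2 ^ u = ((a * 2 ^ u - a' * q : ℤ) : ℝ) / ((q : ℝ) * 2 ^ u) := by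
      push_cast; field_simp
    rw [e, abs_div, abs_of_pos (by positivity : (0 : ℝ) < (q : ℝ) * 2 ^ u),
      div_lt_div_iff₀ (by positivity) (by positivity), one_mul] at hdiff
    have h7 : |((a * 2 ^ u - a' * q : ℤ) : ℝ)| < 1 := by
      have : |((a * 2 ^ u - a' * q : ℤ) : ℝ)| * ((q : ℝ) * 2 ^ u) < 1 * ((q : ℝ) * 2 ^ u) := by linarith
      exact lt_of_mul_lt_mul_right this (by positivity)
    have h8 : |(a * 2 ^ u - a' * q : ℤ)| < 1 := by
      rw [← Int.cast_abs] at h7; exact_mod_cast h7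
    have := Int.abs_lt_one_iff.mp h8
    linarith
  -- Step 4: `q ∣ 2^u`, so `q` is a power of two
  have hdvd : (q : ℤ) ∣ (2 : ℤ) ^ u * a := ⟨a', by rw [mul_comm, hz]; ring⟩
  have hdvd' : (q : ℤ) ∣ (2 : ℤ) ^ u := hcop.symm.dvd_of_dvd_mul_right hdvd
  have hdvdN : q ∣ 2 ^ u := by
    have : (q : ℤ) ∣ ((2 ^ u : ℕ) : ℤ) := by push_cast; exact hdvd'
    exact Int.natCast_dvd_natCast.mp this
  obtain ⟨t, htu, rfl⟩ := (Nat.dvd_prime_pow Nat.prime_two).mp hdvdN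
  exact ⟨t, htu.trans (by omega), rfl⟩

/-! ### Green's Proposition 3 for `λ`: exponential sums at sparse dyadic rationals -/

/-- `expSum λ N θ = afExpSum λ (N-1) θ` (`λ(0) = 0`). [folklore] -/
theorem expSum_liouville_eq_afExpSum {N : ℕ} (hN : 1 ≤ N) (θ : ℝ) :
    expSum (fun x => (liouville x : ℝ)) N θ =
      afExpSum (⇑(liouville : ArithmeticFunction ℝ)) (N - 1) θ := by
  obtain ⟨M, rfl⟩ : ∃ M, N = M + 1 := ⟨N - 1, by omega⟩
  rw [Nat.add_sub_cancel, expSum_succ_eq_afExpSum _ (by simp)]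
  unfold afExpSum
  exact Finset.sum_congr rfl fun x _ => by rw [ArithmeticFunction.intCoe_apply]

/-- `√(log 2ⁿ) = √(log 2) · √n`. [folklore] -/
theorem sqrt_log_two_pow (n : ℕ) :
    Real.sqrt (Real.log ((2 ^ n : ℕ) : ℝ)) = Real.sqrt (Real.log 2) * Real.sqrt n := by
  rw [Nat.cast_pow, Nat.cast_ofNat, Real.log_pow, mul_comm, Real.sqrt_mul' _ (Nat.cast_nonneg n)]

/-- The real inequality behind the gap condition of Lemma 1 in the proof of Proposition 3: if
`200c₁ ≤ (log 2)/2` and `log(72 E^100) < (log 2/2)s` then `36 E^100 e^{200 c₁ s} < e^{(s-1) log 2}`.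
[folklore] -/
theorem sparse_gap_ineq {E c₁ s : ℝ} (hs : 0 ≤ s) (hc₁ : 200 * c₁ ≤ Real.log 2 / 2)
    (hD : Real.log (72 * E ^ 100) < Real.log 2 / 2 * s) :
    36 * E ^ 100 * Real.exp (200 * c₁ * s) < Real.exp ((s - 1) * Real.log 2) := by
  have h1 : 36 * E ^ 100 * Real.exp (200 * c₁ * s) ≤ 36 * E ^ 100 * Real.exp (Real.log 2 / 2 * s) := by
    refine mul_le_mul_of_nonneg_left (Real.exp_le_exp.mpr ?_) (by positivity)
    exact mul_le_mul_of_nonneg_right hc₁ hs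
  have e : Real.exp ((s - 1) * Real.log 2) =
      Real.exp (Real.log 2 / 2 * s) * Real.exp (Real.log 2 / 2 * s) / 2 := by
    rw [← Real.exp_add, eq_div_iff two_ne_zero]
    nth_rewrite 2 [← Real.exp_log two_pos]
    rw [← Real.exp_add]
    congr 1; ring
  have hpos := Real.exp_pos (Real.log 2 / 2 * s)
  rcases eq_or_lt_of_le (show (0 : ℝ) ≤ 72 * E ^ 100 by positivity) with h0 | h0
  · have hE0 : E ^ 100 = 0 := by linarith
    rw [hE0]; simp [Real.exp_pos]
  have h6 : 72 * E ^ 100 < Real.exp (Real.log 2 / 2 * s) := by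
    rw [← Real.log_lt_iff_lt_exp h0]; exact hD
  rw [e]
  have h7 : 36 * E ^ 100 * Real.exp (Real.log 2 / 2 * s) <
      Real.exp (Real.log 2 / 2 * s) * Real.exp (Real.log 2 / 2 * s) / 2 := by
    rw [lt_div_iff₀ two_pos]; nlinarith
  linarith

/-- The real inequality behind the application of Corollary 2 in the proof of Proposition 3: if
`100c₁ ≤ B/2` and `log(3 E^50) ≤ (B/2)s` then `3 E^50 e^{100 c₁ s} ≤ e^{B s}`. [folklore] -/
theorem sparse_cor2_ineq {E c₁ B s : ℝ} (hs : 0 ≤ s) (hc₁ : 100 * c₁ ≤ B / 2)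
    (hD' : Real.log (3 * E ^ 50) ≤ B / 2 * s) :
    3 * E ^ 50 * Real.exp (100 * c₁ * s) ≤ Real.exp (B * s) := by
  have h1 : 3 * E ^ 50 * Real.exp (100 * c₁ * s) ≤ 3 * E ^ 50 * Real.exp (B / 2 * s) := by
    refine mul_le_mul_of_nonneg_left (Real.exp_le_exp.mpr ?_) (by positivity)
    exact mul_le_mul_of_nonneg_right hc₁ hs
  rcases eq_or_lt_of_le (show (0 : ℝ) ≤ 3 * E ^ 50 by positivity) with h0 | h0
  · rw [← h0] at h1 ⊢; rw [zero_mul]; exact (Real.exp_pos _).le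
  have h6 : 3 * E ^ 50 ≤ Real.exp (B / 2 * s) := by
    rw [← Real.log_le_iff_le_exp h0]; exact hD'
  calc 3 * E ^ 50 * Real.exp (100 * c₁ * s) ≤ 3 * E ^ 50 * Real.exp (B / 2 * s) := h1
    _ ≤ Real.exp (B / 2 * s) * Real.exp (B / 2 * s) := mul_le_mul_of_nonneg_right h6 (Real.exp_pos _).le
    _ = Real.exp (B * s) := by rw [← Real.exp_add]; congr 1; ring

/-- **Green 2012, Proposition 3 for the Liouville function** ("exponential sums over Möbius at
sparse dyadic rationals"): there are absolute `c₁ > 0`, `K₁` such that for every `n` and every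
sparse dyadic rational `θ = Σ_i r_i/2^{i+1}` with `k` nonzero numerators, `(k+1)² ≤ n`, and
`|r_i| ≤ e^{c₁√n}`, `‖∑_{x<2ⁿ} λ(x) e(θx)‖ ≤ K₁ 2ⁿ e^{-c₁√n}`. (Green: `k < √n`,
`|r_i| ≤ e^{c₁√log N}`, bound `O(e^{-c₁√log N})`, `N = 2ⁿ`; `√log N = √(log 2)·√n`.) Proof as
printed: if the sum is `≥ δN`, Proposition 4 (`MoebiusExpSum.liouville_minorArc`) gives `a/q` with
`q`, `N|θ - a/q|` polynomial in `log N/δ`; Lemma 1 (`harmanKatai`) forces `q = 2^t`; Corollary 2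
(`liouville_near_dyadic`) then bounds the sum. Conditional on Theorem 3 (`hX`).
[cite: Green2012, Proposition 3 and §1 (remark on λ)] -/
theorem liouville_sparse_dyadic (hX : green_moebius_character_twoPower) :
    ∃ c₁ : ℝ, 0 < c₁ ∧ ∃ K₁ : ℝ, 0 ≤ K₁ ∧ ∀ (n : ℕ) (r : Fin n → ℤ),
      ((Finset.univ.filter (fun i => r i ≠ 0)).card + 1) ^ 2 ≤ n →
      (∀ i, |(r i : ℝ)| ≤ Real.exp (c₁ * Real.sqrt n)) →
      ‖expSum (fun x => (liouville x : ℝ)) (2 ^ n) (dyadic r)‖ ≤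
        K₁ * 2 ^ n * Real.exp (-(c₁ * Real.sqrt n)) := by
  classical
  obtain ⟨C, hC1, hP4⟩ := MoebiusExpSum.liouville_minorArc
  obtain ⟨c₄, hc₄, K₄, hK₄0, hC2⟩ := liouville_near_dyadic hX
  -- constants
  have hlog2 : 0 < Real.log 2 := Real.log_pos (by norm_num)
  have hlog2' : Real.log 2 < 1 := by have := Real.log_two_lt_d9; linarith
  obtain ⟨κ, hκ⟩ : ∃ κ : ℝ, κ = Real.sqrt (Real.log 2) := ⟨_, rfl⟩
  have hκ0 : 0 < κ := by rw [hκ]; exact Real.sqrt_pos.mpr hlog2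
  have hκ1 : κ ≤ 1 := by rw [hκ, Real.sqrt_le_left zero_le_one, one_pow]; exact hlog2'.le
  have hB0 : 0 < c₄ * κ := mul_pos hc₄ hκ0
  obtain ⟨c₁, hc₁⟩ : ∃ c₁ : ℝ, c₁ = min (Real.log 2 / 400) (c₄ * κ / 200) := ⟨_, rfl⟩
  have hc₁0 : 0 < c₁ := by rw [hc₁]; exact lt_min (by positivity) (by positivity)
  have hc₁a : 200 * c₁ ≤ Real.log 2 / 2 := by
    have : c₁ ≤ Real.log 2 / 400 := hc₁ ▸ min_le_left _ _
    linarith only [this]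
  have hc₁b : 100 * c₁ ≤ c₄ * κ / 2 := by
    have : c₁ ≤ c₄ * κ / 200 := hc₁ ▸ min_le_right _ _
    linarith only [this]
  have hc₁c : c₁ ≤ c₄ * κ := by linarith only [hc₁b, hc₁0, hB0]
  have hc₁1 : c₁ ≤ 1 := by linarith only [hc₁a, hlog2', hc₁0]
  obtain ⟨E, hE⟩ : ∃ E : ℝ, E = C * (((8 : ℕ) : ℝ) / c₁) ^ 8 := ⟨_, rfl⟩
  have hE1 : 1 ≤ E := by
    rw [hE]
    have h1 : (1 : ℝ) ≤ ((8 : ℕ) : ℝ) / c₁ := by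
      rw [le_div_iff₀ hc₁0]; norm_num; linarith only [hc₁1]
    have h2 : (1 : ℝ) ≤ (((8 : ℕ) : ℝ) / c₁) ^ 8 := one_le_pow₀ h1
    nlinarith only [hC1, h2]
  have hE0 : 0 ≤ E := by linarith only [hE1]
  obtain ⟨T₀, hT₀⟩ : ∃ T₀ : ℝ, T₀ = max 2 (max (2 * Real.log (72 * E ^ 100) / Real.log 2)
      (2 * Real.log (3 * E ^ 50) / (c₄ * κ))) := ⟨_, rfl⟩
  have hT₀2 : 2 ≤ T₀ := hT₀ ▸ le_max_left _ _
  have hT₀D : 2 * Real.log (72 * E ^ 100) / Real.log 2 ≤ T₀ :=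
    hT₀ ▸ le_trans (le_max_left _ _) (le_max_right _ _)
  have hT₀D' : 2 * Real.log (3 * E ^ 50) / (c₄ * κ) ≤ T₀ :=
    hT₀ ▸ le_trans (le_max_right _ _) (le_max_right _ _)
  obtain ⟨K₁, hK₁⟩ : ∃ K₁ : ℝ, K₁ = (K₄ + 1) * Real.exp (c₁ * T₀) := ⟨_, rfl⟩
  have hK₁1 : 1 ≤ K₁ := by
    rw [hK₁]
    have h2 : (1 : ℝ) ≤ Real.exp (c₁ * T₀) := Real.one_le_exp (by positivity)
    nlinarith only [hK₄0, h2]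
  have hK₁K₄ : K₄ ≤ K₁ := by
    rw [hK₁]
    have h2 : (1 : ℝ) ≤ Real.exp (c₁ * T₀) := Real.one_le_exp (by positivity)
    nlinarith only [hK₄0, h2]
  refine ⟨c₁, hc₁0, K₁, by linarith only [hK₁1], fun n r hk hr => ?_⟩
  -- notation and the trivial bound
  obtain ⟨k, hkdef⟩ : ∃ k : ℕ, k = (Finset.univ.filter (fun i => r i ≠ 0)).card := ⟨_, rfl⟩
  rw [← hkdef] at hk
  obtain ⟨θ, hθ⟩ : ∃ θ : ℝ, θ = dyadic r := ⟨_, rfl⟩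
  rw [← hθ]
  have hliou1 : ∀ x, |(fun x => (liouville x : ℝ)) x| ≤ 1 := fun x => LiouvilleSum.abs_liouville_le_one x
  have htriv := norm_expSum_le hliou1 (2 ^ n) θ
  have hNR : ((2 ^ n : ℕ) : ℝ) = (2 : ℝ) ^ n := by push_cast; ring
  rw [hNR] at htriv
  have hN0 : (0 : ℝ) < (2 : ℝ) ^ n := by positivity
  by_contra hcon
  push Not at hcon
  -- `δ = K₁ e^{-c₁√n} < 1`, hence `√n > T₀`
  obtain ⟨s, hs⟩ : ∃ s : ℝ, s = Real.sqrt n := ⟨_, rfl⟩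
  rw [← hs] at hcon hr
  have hs0 : 0 ≤ s := by rw [hs]; exact Real.sqrt_nonneg _
  obtain ⟨δ, hδ⟩ : ∃ δ : ℝ, δ = K₁ * Real.exp (-(c₁ * s)) := ⟨_, rfl⟩
  have hδ0 : 0 < δ := by rw [hδ]; positivity
  have hδN : δ * 2 ^ n < ‖expSum (fun x => (liouville x : ℝ)) (2 ^ n) θ‖ := by
    rw [hδ]; calc K₁ * Real.exp (-(c₁ * s)) * 2 ^ n = K₁ * 2 ^ n * Real.exp (-(c₁ * s)) := by ring
      _ < _ := hcon
  have hδ1 : δ < 1 := by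
    have : δ * 2 ^ n < 1 * 2 ^ n := by rw [one_mul]; exact lt_of_lt_of_le hδN htriv
    exact lt_of_mul_lt_mul_right this hN0.le
  have hTs : T₀ < s := by
    by_contra hle
    push Not at hle
    have : 1 ≤ δ := by
      rw [hδ, hK₁, mul_assoc, ← Real.exp_add]
      have h2 : (1 : ℝ) ≤ Real.exp (c₁ * T₀ + -(c₁ * s)) :=
        Real.one_le_exp (by nlinarith only [hle, hc₁0])
      nlinarith only [hK₄0, h2]
    linarith only [this, hδ1]
  have hn4 : 4 < n := by
    have h1 : (2 : ℝ) < Real.sqrt n := by rw [← hs]; exact lt_of_le_of_lt hT₀2 hTs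
    rw [Real.lt_sqrt (by norm_num)] at h1
    norm_num at h1
    exact_mod_cast h1
  have hn1 : (1 : ℝ) ≤ n := by exact_mod_cast (by omega : 1 ≤ n)
  have hs1 : 1 ≤ s := by linarith only [hT₀2, hTs]
  -- `N₁ = 2ⁿ - 1 ≥ 3`
  obtain ⟨N₁, hN₁⟩ : ∃ N₁ : ℕ, N₁ = 2 ^ n - 1 := ⟨_, rfl⟩
  have h2n : 2 ^ 5 ≤ 2 ^ n := Nat.pow_le_pow_right (by norm_num) hn4
  have hNN₁ : 2 ^ n = N₁ + 1 := by omega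
  have hN₁3 : 3 ≤ N₁ := by omega
  have hN₁R : (N₁ : ℝ) ≤ (2 : ℝ) ^ n := by
    have : (N₁ : ℝ) ≤ ((2 ^ n : ℕ) : ℝ) := by exact_mod_cast (by omega : N₁ ≤ 2 ^ n)
    rwa [hNR] at this
  have hN₁R' : (2 : ℝ) ^ n ≤ 2 * N₁ := by
    have : ((2 ^ n : ℕ) : ℝ) ≤ 2 * N₁ := by exact_mod_cast (by omega : 2 ^ n ≤ 2 * N₁)
    rwa [hNR] at this
  have hN₁0 : (0 : ℝ) < N₁ := by exact_mod_cast (by omega : 0 < N₁)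
  -- Proposition 4
  have hbig : δ * N₁ ≤ ‖afExpSum (⇑(liouville : ArithmeticFunction ℝ)) N₁ θ‖ := by
    have e := expSum_liouville_eq_afExpSum (Nat.one_le_two_pow (n := n)) θ
    rw [show 2 ^ n - 1 = N₁ from hN₁.symm] at e
    rw [← e]
    calc δ * N₁ ≤ δ * 2 ^ n := mul_le_mul_of_nonneg_left hN₁R hδ0.le
      _ ≤ _ := hδN.le
  obtain ⟨q, hq1, hqle, a, hcop, hθa⟩ := hP4 N₁ hN₁3 θ δ hδ0 hδ1.le hbig
  obtain ⟨P₀, hP₀⟩ : ∃ P₀ : ℝ, P₀ = C * Real.log N₁ ^ 4 / δ := ⟨_, rfl⟩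
  rw [← hP₀] at hqle hθa
  have hC0 : 0 < C := by linarith only [hC1]
  have hlogN₁0 : 1 ≤ Real.log N₁ := MoebiusExpSum.one_le_log_of_three_le hN₁3
  have hP₀1 : 1 ≤ P₀ := by
    rw [hP₀, le_div_iff₀ hδ0, one_mul]
    have h2 : 1 ≤ Real.log N₁ ^ 4 := one_le_pow₀ hlogN₁0
    nlinarith only [hδ1, hC1, h2]
  have hP₀0 : 0 ≤ P₀ := by linarith only [hP₀1]
  -- `P₀ ≤ C n⁴ e^{c₁ s} ≤ E e^{2c₁ s}`
  have hlogN₁ : Real.log N₁ ≤ n := by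
    calc Real.log N₁ ≤ Real.log ((2 : ℝ) ^ n) := Real.log_le_log hN₁0 hN₁R
      _ = n * Real.log 2 := Real.log_pow _ _
      _ ≤ n * 1 := mul_le_mul_of_nonneg_left hlog2'.le (by positivity)
      _ = n := mul_one _
  have hδinv : 1 / δ ≤ Real.exp (c₁ * s) := by
    rw [div_le_iff₀ hδ0, hδ]
    have e : Real.exp (-(c₁ * s)) * Real.exp (c₁ * s) = 1 := by rw [← Real.exp_add]; simp
    calc (1 : ℝ) ≤ K₁ := hK₁1
      _ = K₁ * (Real.exp (-(c₁ * s)) * Real.exp (c₁ * s)) := by rw [e, mul_one]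
      _ = Real.exp (c₁ * s) * (K₁ * Real.exp (-(c₁ * s))) := by ring
  have hn4pow : (n : ℝ) ^ 4 ≤ (((8 : ℕ) : ℝ) / c₁) ^ 8 * Real.exp (c₁ * s) := by
    have h := pow_le_mul_exp 8 hc₁0 hs0
    have e : s ^ 8 = (n : ℝ) ^ 4 := by
      rw [hs, show (8 : ℕ) = 2 * 4 by norm_num, pow_mul, Real.sq_sqrt (by positivity)]
    rw [e] at h; exact h
  have hP₀E : P₀ ≤ E * Real.exp (2 * c₁ * s) := by
    rw [hP₀, hE, div_eq_mul_one_div, show 2 * c₁ * s = c₁ * s + c₁ * s by ring, Real.exp_add]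
    have h1 : Real.log N₁ ^ 4 ≤ (n : ℝ) ^ 4 := pow_le_pow_left₀ (by linarith only [hlogN₁0]) hlogN₁ 4
    calc C * Real.log N₁ ^ 4 * (1 / δ) ≤ C * (n : ℝ) ^ 4 * Real.exp (c₁ * s) := by gcongr
      _ ≤ C * ((((8 : ℕ) : ℝ) / c₁) ^ 8 * Real.exp (c₁ * s)) * Real.exp (c₁ * s) := by gcongr
      _ = C * (((8 : ℕ) : ℝ) / c₁) ^ 8 * (Real.exp (c₁ * s) * Real.exp (c₁ * s)) := by ring
  have hP₀50 : P₀ ^ 50 ≤ E ^ 50 * Real.exp (100 * c₁ * s) := by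
    calc P₀ ^ 50 ≤ (E * Real.exp (2 * c₁ * s)) ^ 50 := pow_le_pow_left₀ hP₀0 hP₀E 50
      _ = E ^ 50 * Real.exp (100 * c₁ * s) := by
          rw [mul_pow, ← Real.exp_nat_mul]; congr 2; push_cast; ring
  -- the parameter of Lemma 1
  obtain ⟨Q, hQ⟩ : ∃ Q : ℝ, Q = 2 * P₀ ^ 50 + Real.exp (c₁ * s) := ⟨_, rfl⟩
  have hexps : 1 ≤ Real.exp (c₁ * s) := Real.one_le_exp (by positivity)
  have hQ1 : 1 ≤ Q := by
    have h50 : (1 : ℝ) ≤ P₀ ^ 50 := one_le_pow₀ hP₀1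
    rw [hQ]; linarith only [h50, hexps]
  have hQle : Q ≤ 3 * E ^ 50 * Real.exp (100 * c₁ * s) := by
    rw [hQ]
    have h1 : Real.exp (c₁ * s) ≤ E ^ 50 * Real.exp (100 * c₁ * s) := by
      have h2 : Real.exp (c₁ * s) ≤ Real.exp (100 * c₁ * s) :=
        Real.exp_le_exp.mpr (by nlinarith only [hc₁0, hs0])
      have h3 : (1 : ℝ) ≤ E ^ 50 := one_le_pow₀ hE1
      nlinarith only [h2, h3, Real.exp_pos (100 * c₁ * s)]
    linarith only [h1, hP₀50]
  -- (i) the gap condition of Lemma 1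
  obtain ⟨g, hg⟩ : ∃ g : ℕ, g = n / (k + 1) := ⟨_, rfl⟩
  have hk1 : ((k : ℝ) + 1) ≤ s := by
    rw [hs, Real.le_sqrt (by positivity) (by positivity)]
    exact_mod_cast hk
  have hgreal : s - 1 ≤ g := by
    have h1 : (n : ℝ) < (g : ℝ) * ((k : ℝ) + 1) + ((k : ℝ) + 1) := by
      have := Nat.lt_div_mul_add (a := n) (b := k + 1) (by omega)
      rw [← hg] at this
      exact_mod_cast this
    have h2 : s * ((k : ℝ) + 1) ≤ n := by
      calc s * ((k : ℝ) + 1) ≤ s * s := mul_le_mul_of_nonneg_left hk1 hs0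
        _ = n := by rw [hs]; exact Real.mul_self_sqrt (by positivity)
    have hk0 : (0 : ℝ) < (k : ℝ) + 1 := by positivity
    have h3 : (s - 1) * ((k : ℝ) + 1) < (g : ℝ) * ((k : ℝ) + 1) := by linarith only [h1, h2]
    exact (lt_of_mul_lt_mul_right h3 hk0.le).le
  have h2g : Real.exp ((s - 1) * Real.log 2) ≤ (2 : ℝ) ^ g := by
    have e : (2 : ℝ) ^ g = Real.exp ((g : ℝ) * Real.log 2) := by
      rw [Real.exp_nat_mul, Real.exp_log two_pos]
    rw [e]
    exact Real.exp_le_exp.mpr (mul_le_mul_of_nonneg_right hgreal hlog2.le)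
  have hgapD : Real.log (72 * E ^ 100) < Real.log 2 / 2 * s := by
    have := lt_of_le_of_lt hT₀D hTs
    rw [div_lt_iff₀ hlog2] at this
    linarith only [this]
  have hgap : 4 * Q ^ 2 < (2 : ℝ) ^ g := by
    refine lt_of_lt_of_le ?_ h2g
    have h1 : 4 * Q ^ 2 ≤ 36 * E ^ 100 * Real.exp (200 * c₁ * s) := by
      have h2 := pow_le_pow_left₀ (by linarith only [hQ1]) hQle 2
      have e : (3 * E ^ 50 * Real.exp (100 * c₁ * s)) ^ 2 = 9 * E ^ 100 * Real.exp (200 * c₁ * s) := by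
        rw [mul_pow, mul_pow, ← pow_mul, ← Real.exp_nat_mul]; push_cast; ring_nf
      rw [e] at h2
      linarith only [h2]
    exact lt_of_le_of_lt h1 (sparse_gap_ineq hs0 hc₁a hgapD)
  -- hypotheses of Lemma 1
  have hP50 : 0 ≤ P₀ ^ 50 := pow_nonneg hP₀0 50
  have hrQ : ∀ i, |(r i : ℝ)| ≤ Q := fun i => (hr i).trans (by rw [hQ]; linarith only [hP50])
  have hqQ : (q : ℝ) ≤ Q := by rw [hQ]; linarith only [hqle, hP50, Real.exp_pos (c₁ * s)]
  have hθQ : |θ - a / q| ≤ Q / 2 ^ n := by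
    refine hθa.trans ?_
    rw [div_le_div_iff₀ hN₁0 hN0, hQ]
    nlinarith only [hN₁R', hP50, Real.exp_pos (c₁ * s), hN₁0]
  have hgap' : 4 * Q ^ 2 < (2 : ℝ) ^ (n / ((Finset.univ.filter (fun i => r i ≠ 0)).card + 1)) := by
    rw [← hkdef, ← hg]; exact hgap
  obtain ⟨t, -, rfl⟩ := harmanKatai r hQ1 hrQ hq1 hqQ hcop (by rw [← hθ]; exact hθQ) hgap'
  -- (ii) Corollary 2 applies: `Q ≤ e^{c₄ κ s}`
  have hcorD : Real.log (3 * E ^ 50) ≤ c₄ * κ / 2 * s := by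
    have := lt_of_le_of_lt hT₀D' hTs
    rw [div_lt_iff₀ hB0] at this
    linarith only [this]
  have hQexp : Q ≤ Real.exp (c₄ * κ * s) := hQle.trans (sparse_cor2_ineq hs0 hc₁b hcorD)
  have hsqlog : Real.sqrt (Real.log ((2 ^ n : ℕ) : ℝ)) = κ * s := by
    rw [hκ, hs]; exact sqrt_log_two_pow n
  have hq2 : (2 : ℝ) ^ t = ((2 ^ t : ℕ) : ℝ) := by push_cast; ring
  have hC2' := hC2 t (2 ^ n) a θ
    (by rw [hsqlog, ← mul_assoc, hq2]; exact hqQ.trans hQexp)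
    (by rw [hsqlog, ← mul_assoc, hNR]; exact hθQ.trans (div_le_div_of_nonneg_right hQexp hN0.le))
  rw [hsqlog, ← mul_assoc, hNR] at hC2'
  -- the contradiction
  have hfinal : ‖expSum (fun x => (liouville x : ℝ)) (2 ^ n) θ‖ ≤ K₁ * 2 ^ n * Real.exp (-(c₁ * s)) := by
    refine hC2'.trans ?_
    have hexp : Real.exp (-(c₄ * κ * s)) ≤ Real.exp (-(c₁ * s)) :=
      Real.exp_le_exp.mpr (by linarith only [mul_le_mul_of_nonneg_right hc₁c hs0])
    gcongr
  linarith only [hfinal, hcon]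

end Green2012

end Literature.NumberTheory.LFunctions
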